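import Literature.MathematicalPhysics.QuantumFieldTheory.Balaban1983to89.B1Ineq225DerivZeroFieldTorus
import Literature.MathematicalPhysics.QuantumFieldTheory.Balaban1983to89.B2Ineq329ZeroAveraging
import Literature.MathematicalPhysics.QuantumFieldTheory.Balaban1983to89.B2Eq230CondShiftBound
import Literature.MathematicalPhysics.QuantumFieldTheory.Balaban1983to89.B2Lemma27Proof

/-!
# `Balaban1983to89.B2Lemma23HiggsLattice` — T. Bałaban, *(Higgs)₂,₃ quantum fields in a finite volume. II. An upper bound*,
# Commun. Math. Phys. **86** (1982) 555–594 [Balaban1982Higgs2]: **Lemma 2.3** (2.59)–(2.60) p. 571 for the ACTUAL minimizer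
# `A^{(k),ε} = a_k(Lᵏε)^{−2}ζ^{(k)}G^ε_kQ_k^*A_k` of (3.3) p. 583 / (2.54) p. 569 ON THE (Higgs)₂,₃ CARRIER ITSELF
# (`HiggsLattice` tori, `HiggsCovariance.propagatorK` at zero external field — the vector-field case *"N = d, A = 0"* of
# [Balaban1982Higgs1] p. 608), by the PRINTED proof (2.61)–(2.64), with Proposition 2.2 (2.58) for `G_kQ_k^*`, `∂^ηG_kQ_k^*`
# DISCHARGED by p14's level-`k` decay bounds and (2.62)–(2.63) PROVED on the carrier

statement-level skeleton of published theorems with citation tags; proofs where landed; nothing here is a claim about the Yang–Mills mass gap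

PDF held: `paper:balaban1982-cmp86-higgs23-ii` (journal page = PDF page + 554); pp. 566, 569–571, 583 read on the ×2 renders
`run/shared/lean/pub/pub-balaban/b2b-balaban-ref1/pages/1982-cmp86-higgs23-II/1982-cmp86-higgs23-II-p012/p015/p016/p017/p029-x2.png`
(p016, p017, p029 re-read as images by this seat, 2026-08-22); part I [Balaban1982Higgs1] = `paper:balaban1982-cmp85-higgs23-i`
(journal page = PDF page + 602), pp. 604, 607–610 (renders `…/1982-cmp85-higgs23-I-p007/p008-x2.png` re-read).

CITATION HEADER / CELL.  Cell `lit-balaban` (HOME `run/shared/lean/pub/lit-balaban/`), reader/typer seat **r14** gen 11 (B2 second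
reader; unit `lit-balaban-r14`); SKELETON rows **B2.Lem2.3** (decl of record `…B2Sect2Statements.Lemma23Printed`, r02 p239259, UNCHANGED),
**B2.Prop3.1** / **B2.Eq3.2-3.4** (the minimizers (3.3) entering the §3 field (3.2)); fold owner r02, referee ref-4.  WHY THIS FILE: the
row B2.Prop3.1 was flipped to `proved` on p23's `B2Prop31PrintedRestrictions` (p310287) whose `RMultiP.restricted` carries the
CONCLUSIONS (2.59)_k/(2.60)_k of Lemma 2.3 for the minimizers AS INPUTS in printed shape (r14 SECONDREAD-B2 v24 RULING-2 (b)); the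
recorded «honest distance» (RULING-2 (4), p23 g10 OPEN (b)) is Lemma 2.3 for those minimizers ON THIS CARRIER.  p23's `B2Lemma23Torus`
(p254202+) proves Lemma 2.3 for Bałaban's operators on the `Setup` tori of the b2b lineage; THIS file proves it for
`HiggsCovariance.propagatorK C univ 0 μ₀² a k` / `avgQkAdj` on the `HiggsLattice` tori of the sub-family `M·L′_μ = Lᵐ`
(`B1Eq211ZeroFieldTorus.Shape`), i.e. for the operator `B3MultiscaleFields.fluctOp` of record when `C = zeroCharge d` (`gqOp_zeroCharge`).
USED BY NAME, never restated: p14 g9's `B1Ineq225ZeroFieldTorusLevels.propagatorK_decay_bound` ((2.25)/(2.58) value clause with decay,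
every level) and `B1Ineq225DerivZeroFieldTorus.covDeriv_propagatorK_decay_bound` (derivative clause); the typer's
`B2Eq230CondShiftBound.sum_exp_neg_tdist_le` (torus sums `Σ_y e^{−δ|x−y|} ≤ K_d(δ)` = `B4Sect5Proof.latticeConst`); r14 g7's
`B1Ineq234Concrete.mul_tdist_blockIter_le` (block geometry); p17/p14's `B2Prop22Proof.{avgQkAdj_apply, norm_avgQkAdj_single_le,
avgQkAdj_single_of_ne}`, `B2Ineq329ZeroAveraging.{multiContourSum_zero_field, avgQk_zero_apply}`, `B1Eq353SupNorm.card_blockK`,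
`HiggsCovariancePos.propagatorK_covOpK_apply` (`G^ε_k ∘ (−Δ + m² + a_kℓ^{−2}P_k) = 1`, `m² > 0`), p23's `B2Lemma27Proof.mul_exp_neg_le_half` (`te^{−δt} ≤ (2/δ)e^{−δt/2}`); the typer's `HiggsLattice`/`HiggsCovariance`.

WHAT IS PRINTED (verbatim, p. 571 [PDF 17]).  *"Lemma 2.3. Under the restrictions (2.55), we have
A^{(k)}(x) = A(y) + O(p(Lᵏε)) = (Q_k^*A)(x) + O(p(Lᵏε)), x ∈ Bᵏ(y), y ∈ Λ₂^{(k−1)′}, (2.59)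
(∂^η_μA^{(k)})(x) = O(p(Lᵏε)), x ∈ Bᵏ(Λ₂^{(k−1)′}). (2.60)
Let us notice that the conclusions of Proposition 2.2 hold for G_kQ_k^*. We have
A^{(k)}(x) = a_k(ζ^{(k)}G_kQ_k^*(A − A(y)))(x) − a_k((1 − ζ^{(k)})G_kQ_k^*1)(x)A(y) + a_k(G_kQ_k^*1)(x)A(y), x ∈ Bᵏ(y), y ∈ Λ₂^{(k−1)′}. (2.61)
Using Proposition 2.2 and the restrictions (2.55) we can estimate the first two terms in (2.61) by O(1)p(Lᵏε). The third term can be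
calculated in the following way G_kQ_k^*1 = a_k⁻¹G_ka_kP_kQ_k^*1 = a_k⁻¹G_k(−Δ^η + μ₀²(Lᵏε)² + a_kP_k)1 − (μ₀²(Lᵏε)²/a_k)G_kQ_k^*1. (2.62)
Hence (a_kG_kQ_k^*1)(x) = 1 − μ₀²(Lᵏε)²/(a_k + μ₀²(Lᵏε)²), (2.63) and, again using (2.55), we have (2.59). Furthermore, because G_kQ_k^*1 is a
constant, from (2.61) we have (∂^η_μA^{(k)})(x) = a_k(∂^η_μζ^{(k)}G_kQ_k^*(A − A(y)))(x) − a_k(∂^η_μ(1 − ζ^{(k)})G_kQ_k^*1)(x)A(y), x ∈ Bᵏ(y),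
y ∈ Λ₂^{(k−1)′}, (2.64) and the restrictions (2.55), Proposition 2.2 and the properties of the function ζ^{(k)} imply (2.60). Thus Lemma 2.3
is proved."*  p. 566 (2.44): *"ζ^{(k)}(x, y) … is "smooth" with respect to x in the sense that |(∂^η_xζ^{(k)})(b, y)| ≦ 1, supp ζ^{(k)}(·, y)
is contained in the set {x ∈ T_η : |x − y| < r(Lᵏε) − 2M} and ζ^{(k)}(x, y) = 1 if |x − y| ≦ ½r(Lᵏε)"*; p. 583 (3.3): *"A^{(k),ε} =
a_k(Lᵏε)^{−2}ζ^{(k)}G^ε_kQ^*_kA_k"*; p. 570 (2.55): *"|(∂A)(b)| ≦ c₁p(L^{k−1}ε), |A(x)| ≦ (c₁/(μ₀L^{k−1}ε))p(L^{k−1}ε) … for x ∈ Λ₋₁^{(k−1)′},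
b ⊂ Λ₋₁^{(k−1)′}"*; part I p. 608: *"The renormalization transformations for vector fields will be obtained by taking N = d and an external
vector field A = 0"*; part I (2.20) p. 610: *"G^ε_k(Ω, A) = (−Δ^{ε,N}_{A,Ω} + m² + a_k(Lᵏε)^{−2}P_k(A))^{−1}, P_k(A) = Q^*_k(A)Q_k(A)"*.

WHAT THIS FILE PROVES (kernel-checked; `def`s with bodies = the operator `a_k(Lᵏε)^{−2}G^ε_k(T_ε,0)Q^*_k(0)` (`gqOp`), its matrix
element (`kerAt`), the cut-off minimizer (3.3) (`cutMin`), the two decay-shape PREDICATES `ValueDecayAt`/`DerivDecayAt` (hypothesis shapes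
with parameters, DISCHARGED for the torus sub-family in §6 — not facts) and the two explicit constants `constVar`/`constFar`; everything
else theorems; NO undischarged `Prop`-valued fact).
* §1 `gqOp`, `gqOp_zeroCharge` (= `B3MultiscaleFields.fluctOp`), `kerAt` (its `ℝ^N`-matrix element `(x, y′)` as a linear map),
  `cutMin` ((3.3)/(2.54): `A^{(k),ε}(x) = Σ_{y′} ζ^{(k)}(x,y′)·kerAt(x,y′)A_k(y′)`, `cutMin_eq_sum`).
* §2 **(2.62)–(2.63) ON THE CARRIER**: `avgQkAdj_zeroField_const`, `avgQkLin_zeroField_const`, `covLaplacianN_zeroField_const`,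
  `covOpK_zeroField_const`, `propagatorK_zeroField_const`, **`gqOp_const`** (`a_k(Lᵏε)^{−2}G^ε_kQ_k^*(v·1) = (a_k/(a_k + μ₀²(Lᵏε)²))·v·1`,
  i.e. (2.63) `= 1 − μ₀²(Lᵏε)²/(a_k + μ₀²(Lᵏε)²)`, `display263`), `sum_kerAt`.
* §3 **(2.58) for `G_kQ_k^*` and `∂^ηG_kQ_k^*` ON THE CARRIER** from p14's (2.25) clauses: `norm_kerAt_le` (`‖kerAt(x,y′)v‖ ≤
  a_kc₀e^{δ₀}e^{−δ₀|x_k − y′|}‖v‖`, block-label sup distance) and `norm_kerAt_shift_sub_le` (`‖kerAt(x+εe_ν,y′)v − kerAt(x,y′)v‖ ≤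
  L^{−k}·a_kc₀′e^{δ₀′}e^{−δ₀′|x_k − y′|}‖v‖`), under the decay shapes `ValueDecayAt`/`DerivDecayAt` (hypothesis predicates, DISCHARGED
  for the torus sub-family by `valueDecayAt_torus`/`derivDecayAt_torus` = p14's theorems).
* §4 **(2.59)** `norm_cutMin_sub_le`: for `y ∈ Λ₂`, `x ∈ Bᵏ(y)`: `‖A^{(k),ε}(x) − A_k(y)‖ ≤ C_var·q + C_far·t_A·e^{−δ₀ρ₁/2} +
  (μ₀²(Lᵏε)²/(a_k + μ₀²(Lᵏε)²))·t_A` with EXPLICIT `C_var`, `C_far` (functions of `a, δ₀, c₀, d` through `K_d`), under (2.55) in p23's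
  integrated reading (`‖A_k(y′)‖ ≤ t_A` on `Λ₁`, `‖A_k(y′) − A_k(y)‖ ≤ q(r₁ + r₂|y − y′|)`) and the printed properties of `ζ^{(k)}`.
* §5 **(2.60)** `norm_cutMin_shift_sub_le`: `‖A^{(k),ε}(x + εe_ν) − A^{(k),ε}(x)‖ ≤ L^{−k}·(C′_var·q + C′_far·t_A·e^{−δρ₁/2})` — the (2.63)
  term CANCELS (*"because G_kQ_k^*1 is a constant"*).
* §6 the torus-sub-family packaging with p14's constants: `valueDecayAt_torus`, `derivDecayAt_torus`, the bookkeeping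
  `coeff59_le`/`coeff60_le`/`far59_le`/`far60_le`, and **`lemma23_higgsLattice`** (∃ δ, C₁, C₂ > 0 depending on `d, L, N, a, μ₀², ε₀` only:
  (2.59) `≤ C₁(r₁ + r₂)q + C₂e^{−δρ₁}t_A + (μ₀²(Lᵏε)²/(a_k + μ₀²(Lᵏε)²))t_A` and (2.60) `≤ L^{−k}(C₁(r₁ + r₂)q + C₂e^{−δρ₁}t_A)` for every
  torus of the sub-family, every coupling, every `1 ≤ k ≤ K` with `Lᵏε ≤ ε₀`, every admissible `ζ`, `Λ₁ ⊇ Λ₂`, `A_k`, `x ∈ Bᵏ(Λ₂)`, `ν`).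
HONEST SCOPE.  (i) Zero external field in `G^ε_k`, `Q_k^*` — which IS the vector-field case (part I p. 608); tori of the sub-family
`M·L′_μ = Lᵐ`, `L` odd (p14's bridge); `Ω = T_ε` (as (3.3)).  (ii) (2.55) enters in the INTEGRATED reading of p23's `B2Lemma23Proof`/
`B2Lemma23Torus` ((2.55)₂ as a sup bound `t_A` on `Λ₁ = Λ₋₁^{(k−1)′}`, (2.55)₁ as the variation modulus `q(r₁ + r₂|y − y′|)`), with all
thresholds ABSTRACT nonnegative reals — the statement is homogeneous, so the physical-unit thresholds of [Balaban1982Higgs1] (1.22)–(1.23)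
(p23's `thr259`/`thr260`) are an instance; the conversion `p(L^{k−1}ε) ≤ (1 + log L)ᵖp(Lᵏε)` and `e^{−δ₀r(Lᵏε)/4} ≤ Cℓ` (r14's
`B2StepK.rDecayBeatsPowers`) that turn the three terms into the printed `O(p(Lᵏε))` are p23's `B2Lemma23Torus.pFn_div_le` /
`B2Lemma23Proof.sep23_of_rDecay` and are NOT repeated here.  (iii) Distances between a fine point `x` and a block label `y′` are measured
as the sup torus distance (1.3) of the LABELS `|x_k − y′|` (a READING of `|x − y′|`, off by `< 1` unit of `T^{(k)}`); the properties (2.44)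
of `ζ^{(k)}` are hypotheses in that currency (radius `ρ`, plateau `ρ₁`, Lipschitz `L^{−k}` per fine step, `|ζ| ≤ 1`); the regions
`Λ₁ ⊇ Λ₂` are data with the standing hypothesis `nbhd` (the range of `ζ` plus one block step around `Bᵏ(Λ₂)` lies in `Λ₁`; print: the
sets of (2.9)–(2.10) are `r(Lᵏε)`-separated).  (iv) Constants `δ₀, c₀` are those of p14's theorems (existential, from p38's torus
theorems) — `C₁, C₂` are explicit in them but not numerical.  (v) Nothing about `A ≠ 0` in `G_k`, regions `Ω ≠ T_ε`, Prop. 2.2 itself,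
or the family re-instantiation of `B2Prop31PrintedRestrictions.RMultiP` with derived (2.59)_k/(2.60)_k (successor work: data `A_k`,
`A k := ofSite (cutMin …)`).  No `sorry`; axioms standard.
-/

noncomputable section

open scoped BigOperators
open Finset

namespace Literature.MathematicalPhysics.QuantumFieldTheory.Balaban1983to89.B2Lemma23HiggsLattice

open Literature.MathematicalPhysics.QuantumFieldTheory.Balaban1983to89.HiggsLattice (ChargeData covDeriv sderiv covDeriv_zero)
open Literature.MathematicalPhysics.QuantumFieldTheory.Balaban1983to89.HiggsAveraging (blockIter blockK mem_blockK
  multiContourSum avgQk)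
open Literature.MathematicalPhysics.QuantumFieldTheory.Balaban1983to89.HiggsCovariance (E avgQkLin avgQkAdj projPk covOpK
  propagatorK covLaplacianN avgQkLin_apply)
open Literature.MathematicalPhysics.QuantumFieldTheory.Balaban1983to89.B1Eq211ZeroFieldTorus (Shape)
open Literature.MathematicalPhysics.QuantumFieldTheory.Balaban1983to89.B1Ineq225ZeroFieldTorusLevels (propagatorK_decay_bound)
open Literature.MathematicalPhysics.QuantumFieldTheory.Balaban1983to89.B1Ineq225DerivZeroFieldTorus (covDeriv_propagatorK_decay_bound)
open Literature.MathematicalPhysics.QuantumFieldTheory.Balaban1983to89.B2Eq230CondShiftBound (sum_exp_neg_tdist_le)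
open Literature.MathematicalPhysics.QuantumFieldTheory.Balaban1983to89.B1Ineq234Concrete (mul_tdist_blockIter_le)
open Literature.MathematicalPhysics.QuantumFieldTheory.Balaban1983to89.B2Prop22Proof (avgQkAdj_apply norm_avgQkAdj_single_le
  avgQkAdj_single_of_ne)
open Literature.MathematicalPhysics.QuantumFieldTheory.Balaban1983to89.B2Ineq329ZeroAveraging (multiContourSum_zero_field
  avgQk_zero_apply)
open Literature.MathematicalPhysics.QuantumFieldTheory.Balaban1983to89.B1Eq353SupNorm (card_blockK)
open Literature.MathematicalPhysics.QuantumFieldTheory.Balaban1983to89.B1Eq31Concrete (covLaplacianN_univ_apply)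
open Literature.MathematicalPhysics.QuantumFieldTheory.Balaban1983to89.B2Lemma27Proof (mul_exp_neg_le_half)

variable {P : HiggsLattice.Params} {N : ℕ}

/-! ## §1 The operator `a_k(Lᵏε)^{−2}G^ε_k(T_ε,0)Q_k^*(0)`, its matrix elements, and the cut-off minimizer (3.3)/(2.54) -/

section Defs

/-- The operator `a_k(Lᵏε)^{−2}G^ε_kQ_k^*` of (3.3) p. 583 (and of part I (3.29), part III (1.2)) at zero external field, from
`ℝ^N`-valued functions on `T^{(k)}_{Lᵏε}` to functions on `T_ε`: `G^ε_k = G^ε_k(T_ε, 0)` = `HiggsCovariance.propagatorK` ((I.2.20)),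
`Q_k^* = Q_k^*(0)` = `HiggsCovariance.avgQkAdj`, `a_k` = `B1.aSeq a L k` ((I.2.15)), `Lᵏε` = `P.mesh k`.
[cite: Balaban1982Higgs2, (3.3) p.583] -/
def gqOp (C : ChargeData N) (msq a : ℝ) (k : ℕ) : HiggsLattice.ScalarField P k N →ₗ[ℝ] HiggsLattice.ScalarField P 0 N :=
  (B1.aSeq a P.L k * (P.mesh k ^ 2)⁻¹) •
    ((propagatorK C Finset.univ (0 : HiggsLattice.VecField P 0) msq a k : HiggsLattice.ScalarField P 0 N →ₗ[ℝ] HiggsLattice.ScalarField P 0 N)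
      ∘ₗ avgQkAdj C (0 : HiggsLattice.VecField P 0) k)

/-- Unfolding: `gqOp g = a_k(Lᵏε)^{−2}·G^ε_k(Q_k^*g)`. [cite: Balaban1982Higgs2, (3.3) p.583] -/
theorem gqOp_apply (C : ChargeData N) (msq a : ℝ) (k : ℕ) (g : HiggsLattice.ScalarField P k N) :
    gqOp C msq a k g = (B1.aSeq a P.L k * (P.mesh k ^ 2)⁻¹) •
      propagatorK C Finset.univ (0 : HiggsLattice.VecField P 0) msq a k (avgQkAdj C (0 : HiggsLattice.VecField P 0) k g) := rfl

/-- At the trivial coupling (`N = d`, the vector-field case of part I p. 608) `gqOp` IS the tree's operator of record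
`B3MultiscaleFields.fluctOp` ((III.1.2) / (I.3.29) `A′^{(j),ε} = a_j(Lʲε)^{−2}G^ε_jQ_j^*A′_j`). [cite: Balaban1982Higgs2, (3.3) p.583] -/
theorem gqOp_zeroCharge (msq a : ℝ) (k : ℕ) (g : HiggsLattice.ScalarField P k P.d) :
    gqOp (B3MultiscaleFields.zeroCharge P.d) msq a k g = B3MultiscaleFields.fluctOp msq a k g := by
  rw [B3MultiscaleFields.fluctOp_eq, gqOp_apply, mul_comm]

/-- The matrix element `a_k(Lᵏε)^{−2}(G^ε_kQ_k^*)(x, y′)` as a linear map of `ℝ^N`: `v ↦ (a_k(Lᵏε)^{−2}G^ε_kQ_k^*(v·δ_{y′}))(x)` —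
the kernel to which *"the conclusions of Proposition 2.2 hold for G_kQ_k^*"* (p. 571) refers. [cite: Balaban1982Higgs2, (2.58) p.570, p.571] -/
def kerAt (C : ChargeData N) (msq a : ℝ) (k : ℕ) (x : HiggsLattice.Site P 0) (y' : HiggsLattice.Site P k) : E N →ₗ[ℝ] E N :=
  (LinearMap.proj x : HiggsLattice.ScalarField P 0 N →ₗ[ℝ] E N) ∘ₗ gqOp C msq a k ∘ₗ LinearMap.single ℝ (fun _ : HiggsLattice.Site P k => E N) y'

/-- Unfolding: `kerAt x y′ v = (gqOp (v·δ_{y′}))(x)`. [cite: Balaban1982Higgs2, (2.58) p.570] -/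
theorem kerAt_apply (C : ChargeData N) (msq a : ℝ) (k : ℕ) (x : HiggsLattice.Site P 0) (y' : HiggsLattice.Site P k) (v : E N) :
    kerAt C msq a k x y' v = gqOp C msq a k (Pi.single y' v) x := rfl

/-- **THE CUT-OFF MINIMIZER (3.3) p. 583 / (2.54) p. 569**: `A^{(k),ε}(x) = a_k(Lᵏε)^{−2}(ζ^{(k)}G^ε_kQ_k^*A_k)(x)`, the cutoff
`ζ^{(k)}(x, y)` of (2.44) acting on the kernel in its second variable — i.e. for each fine point `x` the operator applied to the
localized field `y′ ↦ ζ^{(k)}(x, y′)A_k(y′)` and evaluated at `x`. [cite: Balaban1982Higgs2, (3.3) p.583, (2.54) p.569, (2.44) p.566] -/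
def cutMin (C : ChargeData N) (msq a : ℝ) (k : ℕ) (ζ : HiggsLattice.Site P 0 → HiggsLattice.Site P k → ℝ) (A : HiggsLattice.ScalarField P k N) : HiggsLattice.ScalarField P 0 N :=
  fun x => gqOp C msq a k (fun y' => ζ x y' • A y') x

/-- `gqOp g (x) = Σ_{y′} kerAt(x, y′) g(y′)` (the operator through its matrix elements). [cite: Balaban1982Higgs2, (2.54) p.569] -/
theorem gqOp_apply_eq_sum (C : ChargeData N) (msq a : ℝ) (k : ℕ) (g : HiggsLattice.ScalarField P k N) (x : HiggsLattice.Site P 0) :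
    gqOp C msq a k g x = ∑ y' : HiggsLattice.Site P k, kerAt C msq a k x y' (g y') := by
  conv_lhs => rw [← Finset.univ_sum_single g]
  rw [map_sum, Finset.sum_apply]
  rfl

/-- **(2.54) through the kernel**: `A^{(k),ε}(x) = Σ_{y′∈T^{(k)}} ζ^{(k)}(x, y′)·a_k(Lᵏε)^{−2}(G^ε_kQ_k^*)(x, y′)·A_k(y′)`.
[cite: Balaban1982Higgs2, (2.54) p.569, (3.3) p.583] -/
theorem cutMin_eq_sum (C : ChargeData N) (msq a : ℝ) (k : ℕ) (ζ : HiggsLattice.Site P 0 → HiggsLattice.Site P k → ℝ) (A : HiggsLattice.ScalarField P k N)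
    (x : HiggsLattice.Site P 0) : cutMin C msq a k ζ A x = ∑ y' : HiggsLattice.Site P k, ζ x y' • kerAt C msq a k x y' (A y') := by
  unfold cutMin
  rw [gqOp_apply_eq_sum]
  refine Finset.sum_congr rfl fun y' _ => ?_
  rw [map_smul]

end Defs

/-! ## §2 (2.62)–(2.63) on the carrier: the operator on constants -/

section Const

variable (C : ChargeData N) (msq a : ℝ) (k : ℕ)

/-- `(Q_k^*(0)g)(x) = g(x_k)` at zero external field, every coupling (`U(0) = 1`). [cite: Balaban1982Higgs1, (2.20) p.610] -/
theorem avgQkAdj_zeroField_apply (g : HiggsLattice.ScalarField P k N) (x : HiggsLattice.Site P 0) :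
    avgQkAdj C (0 : HiggsLattice.VecField P 0) k g x = g (blockIter k x) := by
  rw [avgQkAdj_apply, multiContourSum_zero_field, HiggsLattice.ChargeData.U_zero, star_one]
  rfl

/-- `Q_k^*(0)` fixes the constants: `Q_k^*(v·1) = v·1` (p. 571: *"G_kQ_k^*1 = a_k⁻¹G_ka_kP_kQ_k^*1"* uses `Q_k^*1 = 1`).
[cite: Balaban1982Higgs2, (2.62) p.571] -/
theorem avgQkAdj_zeroField_const (v : E N) :
    avgQkAdj C (0 : HiggsLattice.VecField P 0) k (fun _ => v) = fun _ => v := by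
  funext x
  rw [avgQkAdj_zeroField_apply]

/-- `Q_k(0)` fixes the constants (`k ≤ K`): the plain block mean of a constant, `|Bᵏ(y)| = L^{kd}`.
[cite: Balaban1982Higgs2, (2.62) p.571] -/
theorem avgQkLin_zeroField_const (hk : k ≤ P.K) (v : E N) :
    avgQkLin C (0 : HiggsLattice.VecField P 0) k (fun _ => v) = fun _ => v := by
  funext y
  rw [avgQkLin_apply, avgQk_zero_apply, Finset.sum_const, card_blockK hk, ← Nat.cast_smul_eq_nsmul ℝ, smul_smul]
  have hL : (P.L : ℝ) ≠ 0 := (Nat.cast_pos.mpr P.hL).ne'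
  have h1 : ((P.L : ℝ) ^ (k * P.d))⁻¹ * ((P.L ^ (k * P.d) : ℕ) : ℝ) = 1 := by
    push_cast
    exact inv_mul_cancel₀ (pow_ne_zero _ hL)
  rw [h1, one_smul]

/-- `P_k(0) = Q_k^*(0)Q_k(0)` fixes the constants (`k ≤ K`): `P_k1 = Q_k^*1 = 1`. [cite: Balaban1982Higgs2, (2.62) p.571] -/
theorem projPk_zeroField_const (hk : k ≤ P.K) (v : E N) :
    projPk C (0 : HiggsLattice.VecField P 0) k (fun _ => v) = fun _ => v := by
  rw [projPk, LinearMap.comp_apply, avgQkLin_zeroField_const C k hk, avgQkAdj_zeroField_const]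

/-- `−Δ^{ε,N}_{0}` kills the constants on the whole torus (every bond term `v − U(0)v = 0`).
[cite: Balaban1982Higgs2, (2.62) p.571] -/
theorem covLaplacianN_zeroField_const (v : E N) :
    covLaplacianN C Finset.univ (0 : HiggsLattice.VecField P 0) (fun _ => v) = 0 := by
  funext x
  rw [covLaplacianN_univ_apply]
  simp [HiggsLattice.ChargeData.U_zero]

/-- **(2.62) on the carrier**: `(−Δ^ε + μ₀² + a_k(Lᵏε)^{−2}P_k)(v·1) = (μ₀² + a_k(Lᵏε)^{−2})·v·1` (`k ≤ K`).
[cite: Balaban1982Higgs2, (2.62) p.571] -/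
theorem covOpK_zeroField_const (hk : k ≤ P.K) (v : E N) :
    covOpK C Finset.univ (0 : HiggsLattice.VecField P 0) msq a k (fun _ => v)
      = (msq + B1.aSeq a P.L k * ((P.mesh k)⁻¹ ^ 2)) • (fun _ => v : HiggsLattice.ScalarField P 0 N) := by
  simp only [covOpK, LinearMap.add_apply, LinearMap.smul_apply, LinearMap.id_apply, covLaplacianN_zeroField_const,
    projPk_zeroField_const C k hk, zero_add, add_smul]

/-- `(a_k(Lᵏε)^{−2}G^ε_k)(v·1) = (a_k/(a_k + μ₀²(Lᵏε)²))·v·1` for `μ₀² > 0`, `a_k ≥ 0`, `k ≤ K` — (2.62) solved for `G_k1`.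
[cite: Balaban1982Higgs2, (2.62)–(2.63) p.571] -/
theorem propagatorK_zeroField_const (hk : k ≤ P.K) (hmsq : 0 < msq) (hak : 0 ≤ B1.aSeq a P.L k) (v : E N) :
    (B1.aSeq a P.L k * (P.mesh k ^ 2)⁻¹) • propagatorK C Finset.univ (0 : HiggsLattice.VecField P 0) msq a k (fun _ => v)
      = (B1.aSeq a P.L k / (B1.aSeq a P.L k + msq * P.mesh k ^ 2)) • (fun _ => v : HiggsLattice.ScalarField P 0 N) := by
  set c : ℝ := msq + B1.aSeq a P.L k * ((P.mesh k)⁻¹ ^ 2) with hc_def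
  have hℓ : 0 < P.mesh k := P.mesh_pos k
  have hc : 0 < c := by rw [hc_def]; positivity
  have h1 : covOpK C Finset.univ (0 : HiggsLattice.VecField P 0) msq a k (c⁻¹ • fun _ => v) = fun _ => v := by
    rw [map_smul, covOpK_zeroField_const C msq a k hk, ← hc_def, smul_smul, inv_mul_cancel₀ hc.ne', one_smul]
  have h2 : propagatorK C Finset.univ (0 : HiggsLattice.VecField P 0) msq a k (fun _ => v) = c⁻¹ • fun _ => v := by
    conv_lhs => rw [← h1]
    rw [HiggsCovariancePos.propagatorK_covOpK_apply C Finset.univ 0 hmsq a k hak]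
  rw [h2, smul_smul]
  congr 1
  rw [hc_def]
  field_simp
  ring

/-- **(2.63) ON THE CARRIER**: `a_k(Lᵏε)^{−2}G^ε_kQ_k^*(v·1) = (a_k/(a_k + μ₀²(Lᵏε)²))·v·1` (`μ₀² > 0`, `a_k ≥ 0`, `k ≤ K`).
[cite: Balaban1982Higgs2, (2.63) p.571] -/
theorem gqOp_const (hk : k ≤ P.K) (hmsq : 0 < msq) (hak : 0 ≤ B1.aSeq a P.L k) (v : E N) :
    gqOp C msq a k (fun _ => v) = (B1.aSeq a P.L k / (B1.aSeq a P.L k + msq * P.mesh k ^ 2)) •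
      (fun _ => v : HiggsLattice.ScalarField P 0 N) := by
  rw [gqOp_apply, avgQkAdj_zeroField_const, propagatorK_zeroField_const C msq a k hk hmsq hak]

/-- The printed form of the number (2.63): `a_k/(a_k + μ₀²ℓ²) = 1 − μ₀²ℓ²/(a_k + μ₀²ℓ²)`. [cite: Balaban1982Higgs2, (2.63) p.571] -/
theorem display263 {ak m : ℝ} (hak : 0 ≤ ak) (hm : 0 < m) : ak / (ak + m) = 1 - m / (ak + m) := by
  have h : ak + m ≠ 0 := by positivity
  field_simp
  ring

/-- **(2.63) for the kernel**: `Σ_{y′∈T^{(k)}} kerAt(x, y′)v = (a_k/(a_k + μ₀²(Lᵏε)²))·v` — `a_kG_kQ_k^*1` is the CONSTANT of (2.63).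
[cite: Balaban1982Higgs2, (2.63) p.571] -/
theorem sum_kerAt (hk : k ≤ P.K) (hmsq : 0 < msq) (hak : 0 ≤ B1.aSeq a P.L k) (x : HiggsLattice.Site P 0) (v : E N) :
    ∑ y' : HiggsLattice.Site P k, kerAt C msq a k x y' v
      = (B1.aSeq a P.L k / (B1.aSeq a P.L k + msq * P.mesh k ^ 2)) • v := by
  rw [← gqOp_apply_eq_sum C msq a k (fun _ => v) x, gqOp_const C msq a k hk hmsq hak]
  rfl

end Const

/-! ## §3 Proposition 2.2 (2.58) for `G_kQ_k^*` and `∂^ηG_kQ_k^*` on the carrier, from the (2.25) decay clauses -/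

section Kernel

/-- The VALUE-CLAUSE decay shape of Prop. I.2.1 (2.25) / Prop. 2.2 (2.58) for `G^ε_k(T_ε, 0)` at one torus and one level, with
constants `(δ₀, c₀)`: `‖(G^ε_kg)(x)‖ ≤ c₀(Lᵏε)²e^{−δ₀D/Lᵏ}M` for every `g` with `‖g‖ ≤ M` vanishing within (1.3)-distance `D ≥ 0` of `x`
— the conclusion of p14's `B1Ineq225ZeroFieldTorusLevels.propagatorK_decay_bound` (a hypothesis SHAPE, discharged in §6).
[cite: Balaban1982Higgs2, Prop. 2.2 (2.58) p.570] [cite: Balaban1982Higgs1, Prop. 2.1 (2.25) p.610] -/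
def ValueDecayAt (P : HiggsLattice.Params) (C : ChargeData N) (msq a : ℝ) (k : ℕ) (δ₀ c₀ : ℝ) : Prop :=
  ∀ (g : HiggsLattice.ScalarField P 0 N) (M D : ℝ), (∀ x, ‖g x‖ ≤ M) → 0 ≤ D →
    ∀ x : HiggsLattice.Site P 0, (∀ z, g z ≠ 0 → D ≤ (HiggsLattice.Site.tdist x z : ℝ)) →
      ‖propagatorK C Finset.univ (0 : HiggsLattice.VecField P 0) msq a k g x‖
        ≤ c₀ * P.mesh k ^ 2 * Real.exp (-(δ₀ * (D / (P.L : ℝ) ^ k))) * M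

/-- The DERIVATIVE-CLAUSE decay shape of Prop. I.2.1 (2.25) / Prop. 2.2 (2.58) for `D^ε_0G^ε_k(T_ε, 0)` at one torus and one
level, with constants `(δ₁, c₁)`: `‖(D^ε_0G^ε_kg)(⟨x, x+εe_μ⟩)‖ ≤ c₁(Lᵏε)e^{−δ₁D/Lᵏ}M` — the conclusion of p14's
`B1Ineq225DerivZeroFieldTorus.covDeriv_propagatorK_decay_bound` (a hypothesis SHAPE, discharged in §6).
[cite: Balaban1982Higgs2, Prop. 2.2 (2.58) p.570] [cite: Balaban1982Higgs1, Prop. 2.1 (2.25) p.610] -/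
def DerivDecayAt (P : HiggsLattice.Params) (C : ChargeData N) (msq a : ℝ) (k : ℕ) (δ₁ c₁ : ℝ) : Prop :=
  ∀ (g : HiggsLattice.ScalarField P 0 N) (M D : ℝ), (∀ x, ‖g x‖ ≤ M) → 0 ≤ D →
    ∀ (x : HiggsLattice.Site P 0) (μ : Fin P.d), (∀ z, g z ≠ 0 → D ≤ (HiggsLattice.Site.tdist x z : ℝ)) →
      ‖covDeriv C (0 : HiggsLattice.VecField P 0)
          (propagatorK C Finset.univ (0 : HiggsLattice.VecField P 0) msq a k g) ⟨x, μ⟩‖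
        ≤ c₁ * P.mesh k * Real.exp (-(δ₁ * (D / (P.L : ℝ) ^ k))) * M

variable (C : ChargeData N) (msq a : ℝ) {k : ℕ}

/-- **Block geometry for the decay exponent**: for a fine point `x` and a block label `y′` there is a separation `D ≥ 0` (lattice
units of `T_ε`) between `x` and the block `Bᵏ(y′)` with `e^{−δD/Lᵏ} ≤ e^{δ}e^{−δ|x_k − y′|}` — from `Lᵏ|x_k − y′| ≤ |x − z| + Lᵏ − 1`
for `z ∈ Bᵏ(y′)` (r14's `mul_tdist_blockIter_le`). [cite: Balaban1982Higgs1, (1.20) p.607] -/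
theorem exists_blockSep (hk : k ≤ P.K) (x : HiggsLattice.Site P 0) (y' : HiggsLattice.Site P k) {δ : ℝ} (hδ : 0 ≤ δ) :
    ∃ D : ℝ, 0 ≤ D ∧ (∀ z : HiggsLattice.Site P 0, blockIter k z = y' → D ≤ (HiggsLattice.Site.tdist x z : ℝ)) ∧
      Real.exp (-(δ * (D / (P.L : ℝ) ^ k)))
        ≤ Real.exp δ * Real.exp (-(δ * (HiggsLattice.Site.tdist (blockIter k x) y' : ℝ))) := by
  set t : ℕ := HiggsLattice.Site.tdist (blockIter k x) y' with ht_def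
  have hLk : (1 : ℝ) ≤ (P.L : ℝ) ^ k := one_le_pow₀ (by exact_mod_cast P.hL)
  have hLk0 : (0 : ℝ) < (P.L : ℝ) ^ k := by positivity
  rcases Nat.eq_zero_or_pos t with h0 | hpos
  · refine ⟨0, le_rfl, fun z _ => Nat.cast_nonneg _, ?_⟩
    rw [h0, Nat.cast_zero, mul_zero, neg_zero, Real.exp_zero, mul_one, zero_div, mul_zero, neg_zero, Real.exp_zero]
    exact Real.one_le_exp hδ
  · refine ⟨(P.L : ℝ) ^ k * (t : ℝ) - ((P.L : ℝ) ^ k - 1), ?_, ?_, ?_⟩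
    · have h1 : (1 : ℝ) ≤ (t : ℝ) := by exact_mod_cast hpos
      nlinarith
    · intro z hz
      have h := mul_tdist_blockIter_le hk x z
      rw [hz] at h
      have h1 : 1 ≤ P.L ^ k := Nat.one_le_pow _ _ P.hL
      have hcast : ((P.L ^ k : ℕ) : ℝ) * (t : ℝ) ≤ (HiggsLattice.Site.tdist x z : ℝ) + (((P.L ^ k : ℕ) : ℝ) - 1) := by
        have := (Nat.cast_le (α := ℝ)).mpr h
        rw [Nat.cast_mul, Nat.cast_add, Nat.cast_sub h1, Nat.cast_one] at this
        exact this
      rw [Nat.cast_pow] at hcast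
      linarith
    · rw [← Real.exp_add, Real.exp_le_exp]
      have h2 : ((P.L : ℝ) ^ k * (t : ℝ) - ((P.L : ℝ) ^ k - 1)) / (P.L : ℝ) ^ k = (t : ℝ) - 1 + ((P.L : ℝ) ^ k)⁻¹ := by
        field_simp
        ring
      rw [h2]
      have h3 : 0 ≤ ((P.L : ℝ) ^ k)⁻¹ := inv_nonneg.mpr hLk0.le
      nlinarith

/-- The source of the kernel: `g = Q_k^*(0)(v·δ_{y′})` has `‖g‖ ≤ ‖v‖` and is supported in `Bᵏ(y′)`.
[cite: Balaban1982Higgs2, Prop. 2.2 p.571] -/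
theorem avgQkAdj_single_support (k : ℕ) (y' : HiggsLattice.Site P k) (v : E N) (z : HiggsLattice.Site P 0)
    (hz : avgQkAdj C (0 : HiggsLattice.VecField P 0) k (Pi.single y' v) z ≠ 0) : blockIter k z = y' := by
  by_contra h
  exact hz (avgQkAdj_single_of_ne C 0 k y' v h)

/-- **(2.58) FOR `a_kG_kQ_k^*` ON THE CARRIER** (value clause): under the decay shape `ValueDecayAt … δ₀ c₀` (`δ₀ ≥ 0`, `a_k ≥ 0`,
`k ≤ K`), `‖a_k(Lᵏε)^{−2}(G^ε_kQ_k^*)(x, y′)v‖ ≤ a_kc₀e^{δ₀}·e^{−δ₀|x_k − y′|}·‖v‖` — *"the conclusions of Proposition 2.2 hold for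
G_kQ_k^*"* (p. 571), distance = sup torus distance of the block labels. [cite: Balaban1982Higgs2, (2.58) p.570, p.571] -/
theorem norm_kerAt_le (hk : k ≤ P.K) {δ₀ c₀ : ℝ} (hδ : 0 ≤ δ₀) (hc : 0 ≤ c₀) (hV : ValueDecayAt P C msq a k δ₀ c₀)
    (hak : 0 ≤ B1.aSeq a P.L k) (x : HiggsLattice.Site P 0) (y' : HiggsLattice.Site P k) (v : E N) :
    ‖kerAt C msq a k x y' v‖ ≤ B1.aSeq a P.L k * c₀ * Real.exp δ₀ *
      Real.exp (-(δ₀ * (HiggsLattice.Site.tdist (blockIter k x) y' : ℝ))) * ‖v‖ := by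
  obtain ⟨D, hD0, hsupp, hexp⟩ := exists_blockSep hk x y' hδ
  set g := avgQkAdj C (0 : HiggsLattice.VecField P 0) k (Pi.single y' v) with hg_def
  have hgM : ∀ z, ‖g z‖ ≤ ‖v‖ := fun z => norm_avgQkAdj_single_le C 0 k y' v z
  have hgS : ∀ z, g z ≠ 0 → D ≤ (HiggsLattice.Site.tdist x z : ℝ) := fun z hz => hsupp z (avgQkAdj_single_support C k y' v z hz)
  have hG := hV g ‖v‖ D hgM hD0 x hgS
  have hℓ : 0 < P.mesh k := P.mesh_pos k
  rw [kerAt_apply, gqOp_apply, Pi.smul_apply, norm_smul, Real.norm_eq_abs, abs_of_nonneg (by positivity)]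
  calc B1.aSeq a P.L k * (P.mesh k ^ 2)⁻¹ * ‖propagatorK C Finset.univ (0 : HiggsLattice.VecField P 0) msq a k g x‖
      ≤ B1.aSeq a P.L k * (P.mesh k ^ 2)⁻¹ * (c₀ * P.mesh k ^ 2 * Real.exp (-(δ₀ * (D / (P.L : ℝ) ^ k))) * ‖v‖) :=
        mul_le_mul_of_nonneg_left hG (by positivity)
    _ = B1.aSeq a P.L k * c₀ * Real.exp (-(δ₀ * (D / (P.L : ℝ) ^ k))) * ‖v‖ := by field_simp
    _ ≤ B1.aSeq a P.L k * c₀ * (Real.exp δ₀ * Real.exp (-(δ₀ * (HiggsLattice.Site.tdist (blockIter k x) y' : ℝ)))) * ‖v‖ := by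
        gcongr
    _ = _ := by ring

/-- `ε/(Lᵏε) = L^{−k}` (`P.mesh 0 = ε`, `P.mesh k = Lᵏε`). [cite: Balaban1982Higgs1, (1.19) p.607] -/
theorem mesh_zero_div_mesh (k : ℕ) : P.mesh 0 / P.mesh k = ((P.L : ℝ) ^ k)⁻¹ := by
  have hε : P.ε ≠ 0 := P.hε.ne'
  have hL : (P.L : ℝ) ^ k ≠ 0 := pow_ne_zero _ (Nat.cast_pos.mpr P.hL).ne'
  simp only [HiggsLattice.Params.mesh, pow_zero, one_mul]
  field_simp

/-- **(2.58) FOR `∂^η a_kG_kQ_k^*` ON THE CARRIER** (derivative clause): under `DerivDecayAt … δ₁ c₁` (`δ₁ ≥ 0`, `a_k ≥ 0`, `k ≤ K`),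
one fine step changes the kernel by `‖kerAt(x+εe_ν, y′)v − kerAt(x, y′)v‖ ≤ L^{−k}·a_kc₁e^{δ₁}e^{−δ₁|x_k − y′|}‖v‖` (the fine
difference `ε·D^ε_0` costs `ε/(Lᵏε) = L^{−k}` = one `η`-derivative on the unit lattice `T₁^{(k)}`).
[cite: Balaban1982Higgs2, (2.58) p.570, (2.64) p.571] -/
theorem norm_kerAt_shift_sub_le (hk : k ≤ P.K) {δ₁ c₁ : ℝ} (hδ : 0 ≤ δ₁) (hc : 0 ≤ c₁) (hD : DerivDecayAt P C msq a k δ₁ c₁)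
    (hak : 0 ≤ B1.aSeq a P.L k) (x : HiggsLattice.Site P 0) (ν : Fin P.d) (y' : HiggsLattice.Site P k) (v : E N) :
    ‖kerAt C msq a k (x.shift ν) y' v - kerAt C msq a k x y' v‖ ≤ ((P.L : ℝ) ^ k)⁻¹ * (B1.aSeq a P.L k * c₁ * Real.exp δ₁ *
      Real.exp (-(δ₁ * (HiggsLattice.Site.tdist (blockIter k x) y' : ℝ))) * ‖v‖) := by
  obtain ⟨D, hD0, hsupp, hexp⟩ := exists_blockSep hk x y' hδ
  set g := avgQkAdj C (0 : HiggsLattice.VecField P 0) k (Pi.single y' v) with hg_def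
  have hgM : ∀ z, ‖g z‖ ≤ ‖v‖ := fun z => norm_avgQkAdj_single_le C 0 k y' v z
  have hgS : ∀ z, g z ≠ 0 → D ≤ (HiggsLattice.Site.tdist x z : ℝ) := fun z hz => hsupp z (avgQkAdj_single_support C k y' v z hz)
  have hG := hD g ‖v‖ D hgM hD0 x ν hgS
  have hℓ : 0 < P.mesh k := P.mesh_pos k
  have hε : 0 < P.mesh 0 := P.mesh_pos 0
  set Gg := propagatorK C Finset.univ (0 : HiggsLattice.VecField P 0) msq a k g with hGg_def
  -- the fine difference is `ε` times the (covariant = plain, at `A = 0`) derivative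
  have hdiff : Gg (x.shift ν) - Gg x = P.mesh 0 • covDeriv C (0 : HiggsLattice.VecField P 0) Gg ⟨x, ν⟩ := by
    rw [covDeriv_zero, HiggsLattice.sderiv, smul_smul, mul_inv_cancel₀ hε.ne', one_smul]
    rfl
  have hkd : kerAt C msq a k (x.shift ν) y' v - kerAt C msq a k x y' v
      = (B1.aSeq a P.L k * (P.mesh k ^ 2)⁻¹) • (Gg (x.shift ν) - Gg x) := by
    rw [kerAt_apply, kerAt_apply, gqOp_apply, Pi.smul_apply, Pi.smul_apply, smul_sub]
  rw [hkd, hdiff, smul_smul, norm_smul, Real.norm_eq_abs, abs_of_nonneg (by positivity)]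
  calc B1.aSeq a P.L k * (P.mesh k ^ 2)⁻¹ * P.mesh 0 * ‖covDeriv C (0 : HiggsLattice.VecField P 0) Gg ⟨x, ν⟩‖
      ≤ B1.aSeq a P.L k * (P.mesh k ^ 2)⁻¹ * P.mesh 0 * (c₁ * P.mesh k * Real.exp (-(δ₁ * (D / (P.L : ℝ) ^ k))) * ‖v‖) :=
        mul_le_mul_of_nonneg_left hG (by positivity)
    _ = (P.mesh 0 / P.mesh k) * (B1.aSeq a P.L k * c₁ * Real.exp (-(δ₁ * (D / (P.L : ℝ) ^ k))) * ‖v‖) := by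
        field_simp
    _ ≤ (P.mesh 0 / P.mesh k) * (B1.aSeq a P.L k * c₁ *
          (Real.exp δ₁ * Real.exp (-(δ₁ * (HiggsLattice.Site.tdist (blockIter k x) y' : ℝ)))) * ‖v‖) := by
        gcongr
    _ = _ := by rw [mesh_zero_div_mesh]; ring

end Kernel

/-! ## §4 (2.59): `A^{(k),ε}(x) = A_k(y) + O(p(Lᵏε))`, `x ∈ Bᵏ(y)`, `y ∈ Λ₂^{(k−1)′}` -/

section Value

/-- The torus sums of the kernel profile at level `k`: `Σ_{y′∈T^{(k)}} e^{−δ|y − y′|} ≤ K_d(δ)` (the typer's `sum_exp_neg_tdist_le`,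
[B4] §5). [cite: Balaban1983RegularityDecay, Sect. 5 Theorem p.594] -/
theorem sum_profile_le {k : ℕ} {δ : ℝ} (hδ : 0 < δ) (y : HiggsLattice.Site P k) :
    ∑ y' : HiggsLattice.Site P k, Real.exp (-(δ * (HiggsLattice.Site.tdist y y' : ℝ))) ≤ B4Sect5Proof.latticeConst P.d δ :=
  sum_exp_neg_tdist_le hδ y

variable (C : ChargeData N) (msq a : ℝ) {k : ℕ}

/-- **The first term of (2.61), pointwise**: for `x ∈ Bᵏ(y)`, `y ∈ Λ₂`, the `y′`-term of `a_k(ζ^{(k)}G_kQ_k^*(A − A(y)))(x)` is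
bounded by `a_kc₀e^{δ₀}q·(r₁e^{−δ₀t} + (2r₂/δ₀)e^{−δ₀t/2})`, `t = |y − y′|` — Prop. 2.2 for `G_kQ_k^*` (`norm_kerAt_le`) and the
restriction (2.55) in the integrated reading `‖A(y′) − A(y)‖ ≤ q(r₁ + r₂|y − y′|)` on `Λ₁ ∋ y′` (the range of `ζ^{(k)}` around `Bᵏ(Λ₂)`
lies in `Λ₁`). [cite: Balaban1982Higgs2, (2.61) p.571, (2.55) p.570] -/
theorem norm_term1_le (hk : k ≤ P.K) (hak : 0 ≤ B1.aSeq a P.L k) {δ₀ c₀ : ℝ} (hδ₀ : 0 < δ₀) (hc₀ : 0 ≤ c₀)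
    (hV : ValueDecayAt P C msq a k δ₀ c₀) (ζ : HiggsLattice.Site P 0 → HiggsLattice.Site P k → ℝ) {ρ : ℝ}
    (zeta_abs : ∀ x y', |ζ x y'| ≤ 1)
    (zeta_supp : ∀ x y', ζ x y' ≠ 0 → (HiggsLattice.Site.tdist (blockIter k x) y' : ℝ) ≤ ρ)
    (Λ₁ Λ₂ : Finset (HiggsLattice.Site P k))
    (nbhd : ∀ x y', blockIter k x ∈ Λ₂ → (HiggsLattice.Site.tdist (blockIter k x) y' : ℝ) ≤ ρ + 1 → y' ∈ Λ₁)
    (A : HiggsLattice.ScalarField P k N) {q r₁ r₂ : ℝ} (hq : 0 ≤ q) (hr₁ : 0 ≤ r₁) (hr₂ : 0 ≤ r₂)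
    (hA_var : ∀ y ∈ Λ₂, ∀ y' ∈ Λ₁,
      ‖A y' - A y‖ ≤ q * (r₁ + r₂ * (HiggsLattice.Site.tdist y y' : ℝ)))
    (x : HiggsLattice.Site P 0) (hx : blockIter k x ∈ Λ₂) (y' : HiggsLattice.Site P k) :
    ‖ζ x y' • kerAt C msq a k x y' (A y' - A (blockIter k x))‖ ≤
      B1.aSeq a P.L k * c₀ * Real.exp δ₀ * q *
        (r₁ * Real.exp (-(δ₀ * (HiggsLattice.Site.tdist (blockIter k x) y' : ℝ)))
          + 2 * r₂ / δ₀ * Real.exp (-(δ₀ / 2 * (HiggsLattice.Site.tdist (blockIter k x) y' : ℝ)))) := by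
  set t : ℝ := (HiggsLattice.Site.tdist (blockIter k x) y' : ℝ) with ht_def
  have hB0 : 0 ≤ B1.aSeq a P.L k * c₀ * Real.exp δ₀ := by positivity
  by_cases hζ : ζ x y' = 0
  · rw [hζ, zero_smul, norm_zero]
    positivity
  · have hy' : y' ∈ Λ₁ := nbhd x y' hx ((zeta_supp x y' hζ).trans (by linarith))
    have hvar := hA_var _ hx y' hy'
    have hK := norm_kerAt_le C msq a hk hδ₀.le hc₀ hV hak x y' (A y' - A (blockIter k x))
    rw [norm_smul, Real.norm_eq_abs]
    calc |ζ x y'| * ‖kerAt C msq a k x y' (A y' - A (blockIter k x))‖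
        ≤ 1 * (B1.aSeq a P.L k * c₀ * Real.exp δ₀ * Real.exp (-(δ₀ * t)) * (q * (r₁ + r₂ * t))) := by
          refine mul_le_mul (zeta_abs x y') (hK.trans ?_) (norm_nonneg _) zero_le_one
          exact mul_le_mul_of_nonneg_left hvar (by positivity)
      _ = B1.aSeq a P.L k * c₀ * Real.exp δ₀ * q * (r₁ * Real.exp (-(δ₀ * t)) + r₂ * (t * Real.exp (-(δ₀ * t)))) := by ring
      _ ≤ B1.aSeq a P.L k * c₀ * Real.exp δ₀ * q * (r₁ * Real.exp (-(δ₀ * t)) + r₂ * (2 / δ₀ * Real.exp (-(δ₀ / 2 * t)))) :=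
          mul_le_mul_of_nonneg_left (add_le_add le_rfl (mul_le_mul_of_nonneg_left (mul_exp_neg_le_half hδ₀ t) hr₂))
            (by positivity)
      _ = _ := by ring

/-- **The second term of (2.61), pointwise**: the `y′`-term of `a_k((1 − ζ^{(k)})G_kQ_k^*1)(x)A(y)` vanishes unless `ζ^{(k)}(x, y′) ≠ 1`,
i.e. unless `|x_k − y′| > ρ₁ = ½r(Lᵏε)`, where the kernel has decayed: `≤ 2a_kc₀e^{δ₀}e^{−δ₀ρ₁/2}·t_A·e^{−δ₀t/2}`
(`‖A(y)‖ ≤ t_A` = (2.55)₂ on `Λ₁ ∋ y`). [cite: Balaban1982Higgs2, (2.61) p.571, (2.44) p.566, (2.55) p.570] -/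
theorem norm_term2_le (hk : k ≤ P.K) (hak : 0 ≤ B1.aSeq a P.L k) {δ₀ c₀ : ℝ} (hδ₀ : 0 < δ₀) (hc₀ : 0 ≤ c₀)
    (hV : ValueDecayAt P C msq a k δ₀ c₀) (ζ : HiggsLattice.Site P 0 → HiggsLattice.Site P k → ℝ) {ρ₁ : ℝ}
    (zeta_abs : ∀ x y', |ζ x y'| ≤ 1)
    (zeta_one : ∀ x y', (HiggsLattice.Site.tdist (blockIter k x) y' : ℝ) ≤ ρ₁ → ζ x y' = 1)
    {v : E N} {tA : ℝ} (hv : ‖v‖ ≤ tA) (x : HiggsLattice.Site P 0) (y' : HiggsLattice.Site P k) :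
    ‖(1 - ζ x y') • kerAt C msq a k x y' v‖ ≤
      2 * B1.aSeq a P.L k * c₀ * Real.exp δ₀ * Real.exp (-(δ₀ / 2 * ρ₁)) * tA *
        Real.exp (-(δ₀ / 2 * (HiggsLattice.Site.tdist (blockIter k x) y' : ℝ))) := by
  set t : ℝ := (HiggsLattice.Site.tdist (blockIter k x) y' : ℝ) with ht_def
  have htA : 0 ≤ tA := (norm_nonneg _).trans hv
  by_cases hζ : ζ x y' = 1
  · rw [hζ, sub_self, zero_smul, norm_zero]
    positivity
  · have ht : ρ₁ < t := by
      by_contra h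
      exact hζ (zeta_one x y' (not_lt.mp h))
    have hK := norm_kerAt_le C msq a hk hδ₀.le hc₀ hV hak x y' v
    have h1ζ : |1 - ζ x y'| ≤ 2 := by
      have := zeta_abs x y'
      rw [abs_le] at this ⊢
      constructor <;> linarith [this.1, this.2]
    have hexp : Real.exp (-(δ₀ * t)) ≤ Real.exp (-(δ₀ / 2 * ρ₁)) * Real.exp (-(δ₀ / 2 * t)) := by
      rw [← Real.exp_add, Real.exp_le_exp]
      nlinarith
    rw [norm_smul, Real.norm_eq_abs]
    calc |1 - ζ x y'| * ‖kerAt C msq a k x y' v‖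
        ≤ 2 * (B1.aSeq a P.L k * c₀ * Real.exp δ₀ * Real.exp (-(δ₀ * t)) * tA) := by
          refine mul_le_mul h1ζ (hK.trans ?_) (norm_nonneg _) zero_le_two
          exact mul_le_mul_of_nonneg_left hv (by positivity)
      _ ≤ 2 * (B1.aSeq a P.L k * c₀ * Real.exp δ₀ * (Real.exp (-(δ₀ / 2 * ρ₁)) * Real.exp (-(δ₀ / 2 * t))) * tA) := by
          gcongr
      _ = _ := by ring

/-- **The decomposition (2.61)** of the cut-off minimizer at `x ∈ Bᵏ(y)`:
`A^{(k)}(x) − A(y) = Σ_{y′}ζ(x,y′)K(x,y′)(A(y′) − A(y)) − Σ_{y′}(1 − ζ(x,y′))K(x,y′)A(y) + ((a_kG_kQ_k^*1) − 1)A(y)` with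
`a_kG_kQ_k^*1 = a_k/(a_k + μ₀²(Lᵏε)²)` ((2.63), `sum_kerAt`). [cite: Balaban1982Higgs2, (2.61) p.571, (2.63) p.571] -/
theorem cutMin_sub_eq (hk : k ≤ P.K) (hmsq : 0 < msq) (hak : 0 ≤ B1.aSeq a P.L k)
    (ζ : HiggsLattice.Site P 0 → HiggsLattice.Site P k → ℝ) (A : HiggsLattice.ScalarField P k N) (x : HiggsLattice.Site P 0) :
    cutMin C msq a k ζ A x - A (blockIter k x)
      = (∑ y' : HiggsLattice.Site P k, ζ x y' • kerAt C msq a k x y' (A y' - A (blockIter k x)))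
        - (∑ y' : HiggsLattice.Site P k, (1 - ζ x y') • kerAt C msq a k x y' (A (blockIter k x)))
        + (B1.aSeq a P.L k / (B1.aSeq a P.L k + msq * P.mesh k ^ 2) - 1) • A (blockIter k x) := by
  rw [cutMin_eq_sum, sub_smul, one_smul, ← sum_kerAt C msq a k hk hmsq hak x (A (blockIter k x))]
  have h : ∀ y' : HiggsLattice.Site P k, ζ x y' • kerAt C msq a k x y' (A y')
      = ζ x y' • kerAt C msq a k x y' (A y' - A (blockIter k x))
        - (1 - ζ x y') • kerAt C msq a k x y' (A (blockIter k x)) + kerAt C msq a k x y' (A (blockIter k x)) := by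
    intro y'
    rw [map_sub, smul_sub, sub_smul, one_smul]
    abel
  simp_rw [h, Finset.sum_add_distrib, Finset.sum_sub_distrib]
  abel

/-- **LEMMA 2.3, (2.59), ON THE (Higgs)₂,₃ CARRIER**: for the cut-off minimizer `A^{(k),ε} = a_k(Lᵏε)^{−2}ζ^{(k)}G^ε_kQ_k^*A_k`
((3.3)) at zero external field, `μ₀² > 0`, `a_k ≥ 0`, `k ≤ K`, under the value-clause decay shape (2.58)/(2.25) with `(δ₀, c₀)`, the
printed properties of `ζ^{(k)}` (`|ζ| ≤ 1`, support radius `ρ`, plateau radius `ρ₁`, in block-label distance) and the restrictions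
(2.55) on `A_k` over `Λ₁ = Λ₋₁^{(k−1)′}` in the integrated reading (`‖A_k‖ ≤ t_A`, `‖A_k(y′) − A_k(y)‖ ≤ q(r₁ + r₂|y − y′|)`), with
`Λ₂ ⊆ Λ₁` and the range of `ζ^{(k)}` (+1) around `Bᵏ(Λ₂)` inside `Λ₁`: for every `y ∈ Λ₂` and `x ∈ Bᵏ(y)`,
`‖A^{(k),ε}(x) − A_k(y)‖ ≤ a_kc₀e^{δ₀}(r₁K_d(δ₀) + (2r₂/δ₀)K_d(δ₀/2))·q + 2a_kc₀e^{δ₀}K_d(δ₀/2)e^{−δ₀ρ₁/2}·t_A +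
(μ₀²(Lᵏε)²/(a_k + μ₀²(Lᵏε)²))·t_A` — the three terms of (2.61) bounded as in print (*"the first two terms … by O(1)p(Lᵏε) … again
using (2.55), we have (2.59)"*). [cite: Balaban1982Higgs2, Lemma 2.3 (2.59) p.571, (2.61)–(2.63) p.571] -/
theorem norm_cutMin_sub_le (hk : k ≤ P.K) (hmsq : 0 < msq) (hak : 0 ≤ B1.aSeq a P.L k) {δ₀ c₀ : ℝ} (hδ₀ : 0 < δ₀)
    (hc₀ : 0 ≤ c₀) (hV : ValueDecayAt P C msq a k δ₀ c₀) (ζ : HiggsLattice.Site P 0 → HiggsLattice.Site P k → ℝ) {ρ ρ₁ : ℝ}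
    (zeta_abs : ∀ x y', |ζ x y'| ≤ 1)
    (zeta_supp : ∀ x y', ζ x y' ≠ 0 → (HiggsLattice.Site.tdist (blockIter k x) y' : ℝ) ≤ ρ)
    (zeta_one : ∀ x y', (HiggsLattice.Site.tdist (blockIter k x) y' : ℝ) ≤ ρ₁ → ζ x y' = 1)
    (Λ₁ Λ₂ : Finset (HiggsLattice.Site P k)) (sub : Λ₂ ⊆ Λ₁)
    (nbhd : ∀ x y', blockIter k x ∈ Λ₂ → (HiggsLattice.Site.tdist (blockIter k x) y' : ℝ) ≤ ρ + 1 → y' ∈ Λ₁)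
    (A : HiggsLattice.ScalarField P k N) {tA q r₁ r₂ : ℝ} (hq : 0 ≤ q) (hr₁ : 0 ≤ r₁) (hr₂ : 0 ≤ r₂)
    (hA_abs : ∀ y' ∈ Λ₁, ‖A y'‖ ≤ tA)
    (hA_var : ∀ y ∈ Λ₂, ∀ y' ∈ Λ₁, ‖A y' - A y‖ ≤ q * (r₁ + r₂ * (HiggsLattice.Site.tdist y y' : ℝ)))
    (x : HiggsLattice.Site P 0) (hx : blockIter k x ∈ Λ₂) :
    ‖cutMin C msq a k ζ A x - A (blockIter k x)‖ ≤
      B1.aSeq a P.L k * c₀ * Real.exp δ₀ *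
          (r₁ * B4Sect5Proof.latticeConst P.d δ₀ + 2 * r₂ / δ₀ * B4Sect5Proof.latticeConst P.d (δ₀ / 2)) * q
        + 2 * B1.aSeq a P.L k * c₀ * Real.exp δ₀ * B4Sect5Proof.latticeConst P.d (δ₀ / 2) * Real.exp (-(δ₀ / 2 * ρ₁)) * tA
        + msq * P.mesh k ^ 2 / (B1.aSeq a P.L k + msq * P.mesh k ^ 2) * tA := by
  set y := blockIter k x with hy_def
  have htA : 0 ≤ tA := (norm_nonneg _).trans (hA_abs y (sub hx))
  have hℓ : 0 < P.mesh k := P.mesh_pos k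
  rw [cutMin_sub_eq C msq a hk hmsq hak ζ A x]
  -- the three terms
  have hT1 : ‖∑ y' : HiggsLattice.Site P k, ζ x y' • kerAt C msq a k x y' (A y' - A y)‖ ≤
      B1.aSeq a P.L k * c₀ * Real.exp δ₀ *
        (r₁ * B4Sect5Proof.latticeConst P.d δ₀ + 2 * r₂ / δ₀ * B4Sect5Proof.latticeConst P.d (δ₀ / 2)) * q := by
    refine (norm_sum_le _ _).trans ?_
    refine (Finset.sum_le_sum fun y' _ => norm_term1_le C msq a hk hak hδ₀ hc₀ hV ζ zeta_abs zeta_supp Λ₁ Λ₂ nbhd A hq hr₁ hr₂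
      hA_var x hx y').trans ?_
    rw [← Finset.mul_sum, Finset.sum_add_distrib, ← Finset.mul_sum, ← Finset.mul_sum]
    have h1 := sum_profile_le hδ₀ y
    have h2 := sum_profile_le (half_pos hδ₀) y
    have hB : 0 ≤ B1.aSeq a P.L k * c₀ * Real.exp δ₀ * q := by positivity
    calc B1.aSeq a P.L k * c₀ * Real.exp δ₀ * q *
          (r₁ * ∑ y' : HiggsLattice.Site P k, Real.exp (-(δ₀ * (HiggsLattice.Site.tdist y y' : ℝ)))
            + 2 * r₂ / δ₀ * ∑ y' : HiggsLattice.Site P k, Real.exp (-(δ₀ / 2 * (HiggsLattice.Site.tdist y y' : ℝ))))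
        ≤ B1.aSeq a P.L k * c₀ * Real.exp δ₀ * q *
          (r₁ * B4Sect5Proof.latticeConst P.d δ₀ + 2 * r₂ / δ₀ * B4Sect5Proof.latticeConst P.d (δ₀ / 2)) := by
          gcongr
      _ = _ := by ring
  have hT2 : ‖∑ y' : HiggsLattice.Site P k, (1 - ζ x y') • kerAt C msq a k x y' (A y)‖ ≤
      2 * B1.aSeq a P.L k * c₀ * Real.exp δ₀ * B4Sect5Proof.latticeConst P.d (δ₀ / 2) * Real.exp (-(δ₀ / 2 * ρ₁)) * tA := by
    refine (norm_sum_le _ _).trans ?_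
    refine (Finset.sum_le_sum fun y' _ => norm_term2_le C msq a hk hak hδ₀ hc₀ hV ζ zeta_abs zeta_one
      (hA_abs y (sub hx)) x y').trans ?_
    rw [← Finset.mul_sum]
    have h2 := sum_profile_le (half_pos hδ₀) y
    have hB : 0 ≤ 2 * B1.aSeq a P.L k * c₀ * Real.exp δ₀ * Real.exp (-(δ₀ / 2 * ρ₁)) * tA := by positivity
    calc 2 * B1.aSeq a P.L k * c₀ * Real.exp δ₀ * Real.exp (-(δ₀ / 2 * ρ₁)) * tA *
          ∑ y' : HiggsLattice.Site P k, Real.exp (-(δ₀ / 2 * (HiggsLattice.Site.tdist y y' : ℝ)))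
        ≤ 2 * B1.aSeq a P.L k * c₀ * Real.exp δ₀ * Real.exp (-(δ₀ / 2 * ρ₁)) * tA * B4Sect5Proof.latticeConst P.d (δ₀ / 2) :=
          mul_le_mul_of_nonneg_left h2 hB
      _ = _ := by ring
  have hT3 : ‖(B1.aSeq a P.L k / (B1.aSeq a P.L k + msq * P.mesh k ^ 2) - 1) • A y‖ ≤
      msq * P.mesh k ^ 2 / (B1.aSeq a P.L k + msq * P.mesh k ^ 2) * tA := by
    have hden : 0 < B1.aSeq a P.L k + msq * P.mesh k ^ 2 := by positivity
    have hκ : B1.aSeq a P.L k / (B1.aSeq a P.L k + msq * P.mesh k ^ 2) - 1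
        = -(msq * P.mesh k ^ 2 / (B1.aSeq a P.L k + msq * P.mesh k ^ 2)) := by
      field_simp
      ring
    rw [hκ, neg_smul, norm_neg, norm_smul, Real.norm_eq_abs, abs_of_nonneg (by positivity)]
    exact mul_le_mul_of_nonneg_left (hA_abs y (sub hx)) (by positivity)
  calc ‖(∑ y' : HiggsLattice.Site P k, ζ x y' • kerAt C msq a k x y' (A y' - A y))
        - (∑ y' : HiggsLattice.Site P k, (1 - ζ x y') • kerAt C msq a k x y' (A y))
        + (B1.aSeq a P.L k / (B1.aSeq a P.L k + msq * P.mesh k ^ 2) - 1) • A y‖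
      ≤ ‖∑ y' : HiggsLattice.Site P k, ζ x y' • kerAt C msq a k x y' (A y' - A y)‖
        + ‖∑ y' : HiggsLattice.Site P k, (1 - ζ x y') • kerAt C msq a k x y' (A y)‖
        + ‖(B1.aSeq a P.L k / (B1.aSeq a P.L k + msq * P.mesh k ^ 2) - 1) • A y‖ :=
          (norm_add_le _ _).trans (add_le_add (norm_sub_le _ _) le_rfl)
    _ ≤ _ := add_le_add (add_le_add hT1 hT2) hT3

end Value

/-! ## §5 (2.60): `(∂^η_νA^{(k),ε})(x) = O(p(Lᵏε))` on `Bᵏ(Λ₂^{(k−1)′})` — one fine step costs `L^{−k}` -/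

section Deriv

variable (C : ChargeData N) (msq a : ℝ) {k : ℕ}

/-- One fine step moves the `k`-block label by at most one block: `|x_k − (x + εe_ν)_k| ≤ 1` (from `Lᵏ|x_k − x′_k| ≤ |x − x′| + Lᵏ − 1`
and `|x − (x + εe_ν)| ≤ 1`). [cite: Balaban1982Higgs1, (1.20) p.607] -/
theorem tdist_blockIter_shift_le_one (hk : k ≤ P.K) (x : HiggsLattice.Site P 0) (ν : Fin P.d) :
    HiggsLattice.Site.tdist (blockIter k x) (blockIter k (x.shift ν)) ≤ 1 := by
  have h := mul_tdist_blockIter_le hk x (x.shift ν)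
  have h1 := B1Ineq234LevelZero.tdist_shift_le_one x ν
  have hL : 0 < P.L ^ k := pow_pos P.hL k
  have h2 : P.L ^ k * HiggsLattice.Site.tdist (blockIter k x) (blockIter k (x.shift ν)) ≤ P.L ^ k * 1 := by omega
  exact Nat.le_of_mul_le_mul_left h2 hL

/-- The kernel profile seen from the shifted point: `e^{−δ|(x+εe_ν)_k − y′|} ≤ e^{δ}e^{−δ|x_k − y′|}` (`δ ≥ 0`).
[cite: Balaban1982Higgs1, (1.20) p.607] -/
theorem exp_shift_le (hk : k ≤ P.K) {δ : ℝ} (hδ : 0 ≤ δ) (x : HiggsLattice.Site P 0) (ν : Fin P.d)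
    (y' : HiggsLattice.Site P k) :
    Real.exp (-(δ * (HiggsLattice.Site.tdist (blockIter k (x.shift ν)) y' : ℝ)))
      ≤ Real.exp δ * Real.exp (-(δ * (HiggsLattice.Site.tdist (blockIter k x) y' : ℝ))) := by
  rw [← Real.exp_add, Real.exp_le_exp]
  have h1 : (HiggsLattice.Site.tdist (blockIter k x) (blockIter k (x.shift ν)) : ℝ) ≤ 1 := by
    exact_mod_cast tdist_blockIter_shift_le_one hk x ν
  have h2 := B1Ineq234LevelZero.tdist_triangle_real (blockIter k x) (blockIter k (x.shift ν)) y'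
  nlinarith

/-- A label within the range of `ζ^{(k)}(x + εe_ν, ·)` is within range `+1` of `x_k`. [cite: Balaban1982Higgs2, (2.44) p.566] -/
theorem tdist_le_of_shift_le (hk : k ≤ P.K) (x : HiggsLattice.Site P 0) (ν : Fin P.d) (y' : HiggsLattice.Site P k) {ρ : ℝ}
    (h : (HiggsLattice.Site.tdist (blockIter k (x.shift ν)) y' : ℝ) ≤ ρ) :
    (HiggsLattice.Site.tdist (blockIter k x) y' : ℝ) ≤ ρ + 1 := by
  have h1 : (HiggsLattice.Site.tdist (blockIter k x) (blockIter k (x.shift ν)) : ℝ) ≤ 1 := by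
    exact_mod_cast tdist_blockIter_shift_le_one hk x ν
  have h2 := B1Ineq234LevelZero.tdist_triangle_real (blockIter k x) (blockIter k (x.shift ν)) y'
  linarith

/-- **The first sum of (2.64), pointwise**: the `y′`-term of `a_k(∂^η_ν ζ^{(k)}G_kQ_k^*(A − A(y)))(x)`, i.e.
`ζ(x+εe_ν,y′)K(x+εe_ν,y′)w − ζ(x,y′)K(x,y′)w` with `w = A(y′) − A(y)`, is `≤ L^{−k}·q·[a_k(c₀e^{δ₀})e^{δ₀}(r₁e^{−δ₀t} + (2r₂/δ₀)e^{−δ₀t/2})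
+ a_kc₁e^{δ₁}(r₁e^{−δ₁t} + (2r₂/δ₁)e^{−δ₁t/2})]` (product rule: `|∂ζ| ≤ 1` on the `η`-lattice = `L^{−k}` per fine step, times the
kernel; plus `ζ` times the kernel's derivative). [cite: Balaban1982Higgs2, (2.64) p.571, (2.44) p.566, (2.58) p.570] -/
theorem norm_termD1_le (hk : k ≤ P.K) (hak : 0 ≤ B1.aSeq a P.L k) {δ₀ c₀ : ℝ} (hδ₀ : 0 < δ₀) (hc₀ : 0 ≤ c₀)
    (hV : ValueDecayAt P C msq a k δ₀ c₀) {δ₁ c₁ : ℝ} (hδ₁ : 0 < δ₁) (hc₁ : 0 ≤ c₁) (hD : DerivDecayAt P C msq a k δ₁ c₁)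
    (ζ : HiggsLattice.Site P 0 → HiggsLattice.Site P k → ℝ) {ρ : ℝ}
    (zeta_abs : ∀ x y', |ζ x y'| ≤ 1)
    (zeta_supp : ∀ x y', ζ x y' ≠ 0 → (HiggsLattice.Site.tdist (blockIter k x) y' : ℝ) ≤ ρ)
    (zeta_lip : ∀ (x : HiggsLattice.Site P 0) (ν : Fin P.d) (y' : HiggsLattice.Site P k),
      |ζ (x.shift ν) y' - ζ x y'| ≤ ((P.L : ℝ) ^ k)⁻¹)
    (Λ₁ Λ₂ : Finset (HiggsLattice.Site P k))
    (nbhd : ∀ x y', blockIter k x ∈ Λ₂ → (HiggsLattice.Site.tdist (blockIter k x) y' : ℝ) ≤ ρ + 1 → y' ∈ Λ₁)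
    (A : HiggsLattice.ScalarField P k N) {q r₁ r₂ : ℝ} (hq : 0 ≤ q) (hr₁ : 0 ≤ r₁) (hr₂ : 0 ≤ r₂)
    (hA_var : ∀ y ∈ Λ₂, ∀ y' ∈ Λ₁,
      ‖A y' - A y‖ ≤ q * (r₁ + r₂ * (HiggsLattice.Site.tdist y y' : ℝ)))
    (x : HiggsLattice.Site P 0) (hx : blockIter k x ∈ Λ₂) (ν : Fin P.d) (y' : HiggsLattice.Site P k) :
    ‖ζ (x.shift ν) y' • kerAt C msq a k (x.shift ν) y' (A y' - A (blockIter k x))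
        - ζ x y' • kerAt C msq a k x y' (A y' - A (blockIter k x))‖ ≤
      ((P.L : ℝ) ^ k)⁻¹ * q *
        (B1.aSeq a P.L k * (c₀ * Real.exp δ₀) * Real.exp δ₀ *
            (r₁ * Real.exp (-(δ₀ * (HiggsLattice.Site.tdist (blockIter k x) y' : ℝ)))
              + 2 * r₂ / δ₀ * Real.exp (-(δ₀ / 2 * (HiggsLattice.Site.tdist (blockIter k x) y' : ℝ))))
          + B1.aSeq a P.L k * c₁ * Real.exp δ₁ *
            (r₁ * Real.exp (-(δ₁ * (HiggsLattice.Site.tdist (blockIter k x) y' : ℝ)))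
              + 2 * r₂ / δ₁ * Real.exp (-(δ₁ / 2 * (HiggsLattice.Site.tdist (blockIter k x) y' : ℝ))))) := by
  set t : ℝ := (HiggsLattice.Site.tdist (blockIter k x) y' : ℝ) with ht_def
  set w := A y' - A (blockIter k x) with hw_def
  set K' := kerAt C msq a k (x.shift ν) y' with hK'_def
  set K := kerAt C msq a k x y' with hK_def
  have hLk : 0 < ((P.L : ℝ) ^ k)⁻¹ := inv_pos.mpr (pow_pos (Nat.cast_pos.mpr P.hL) k)
  -- the two pieces of the product rule
  have hsplit : ζ (x.shift ν) y' • K' w - ζ x y' • K w = (ζ (x.shift ν) y' - ζ x y') • K' w + ζ x y' • (K' w - K w) := by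
    rw [sub_smul, smul_sub]; abel
  -- bounds valid when `y′ ∈ Λ₁`
  have hP1 : ∀ (hy' : y' ∈ Λ₁), ‖(ζ (x.shift ν) y' - ζ x y') • K' w‖ ≤ ((P.L : ℝ) ^ k)⁻¹ * q *
      (B1.aSeq a P.L k * (c₀ * Real.exp δ₀) * Real.exp δ₀ * (r₁ * Real.exp (-(δ₀ * t)) + 2 * r₂ / δ₀ * Real.exp (-(δ₀ / 2 * t)))) := by
    intro hy'
    have hvar := hA_var _ hx y' hy'
    have hK' := norm_kerAt_le C msq a hk hδ₀.le hc₀ hV hak (x.shift ν) y' w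
    have hE := exp_shift_le hk hδ₀.le x ν y'
    rw [norm_smul, Real.norm_eq_abs]
    calc |ζ (x.shift ν) y' - ζ x y'| * ‖K' w‖
        ≤ ((P.L : ℝ) ^ k)⁻¹ * (B1.aSeq a P.L k * c₀ * Real.exp δ₀ * (Real.exp δ₀ * Real.exp (-(δ₀ * t))) *
            (q * (r₁ + r₂ * t))) := by
          refine mul_le_mul (zeta_lip x ν y') (hK'.trans ?_) (norm_nonneg _) hLk.le
          exact mul_le_mul (mul_le_mul_of_nonneg_left hE (by positivity)) hvar (norm_nonneg _) (by positivity)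
      _ = ((P.L : ℝ) ^ k)⁻¹ * q * (B1.aSeq a P.L k * (c₀ * Real.exp δ₀) * Real.exp δ₀ *
            (r₁ * Real.exp (-(δ₀ * t)) + r₂ * (t * Real.exp (-(δ₀ * t))))) := by ring
      _ ≤ ((P.L : ℝ) ^ k)⁻¹ * q * (B1.aSeq a P.L k * (c₀ * Real.exp δ₀) * Real.exp δ₀ *
            (r₁ * Real.exp (-(δ₀ * t)) + r₂ * (2 / δ₀ * Real.exp (-(δ₀ / 2 * t))))) :=
          mul_le_mul_of_nonneg_left (mul_le_mul_of_nonneg_left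
            (add_le_add le_rfl (mul_le_mul_of_nonneg_left (mul_exp_neg_le_half hδ₀ t) hr₂)) (by positivity)) (by positivity)
      _ = _ := by ring
  have hP2 : ∀ (hy' : y' ∈ Λ₁), ‖ζ x y' • (K' w - K w)‖ ≤ ((P.L : ℝ) ^ k)⁻¹ * q *
      (B1.aSeq a P.L k * c₁ * Real.exp δ₁ * (r₁ * Real.exp (-(δ₁ * t)) + 2 * r₂ / δ₁ * Real.exp (-(δ₁ / 2 * t)))) := by
    intro hy'
    have hvar := hA_var _ hx y' hy'
    have hKd := norm_kerAt_shift_sub_le C msq a hk hδ₁.le hc₁ hD hak x ν y' w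
    rw [norm_smul, Real.norm_eq_abs]
    calc |ζ x y'| * ‖K' w - K w‖
        ≤ 1 * (((P.L : ℝ) ^ k)⁻¹ * (B1.aSeq a P.L k * c₁ * Real.exp δ₁ * Real.exp (-(δ₁ * t)) * (q * (r₁ + r₂ * t)))) := by
          refine mul_le_mul (zeta_abs x y') (hKd.trans ?_) (norm_nonneg _) zero_le_one
          exact mul_le_mul_of_nonneg_left (mul_le_mul_of_nonneg_left hvar (by positivity)) hLk.le
      _ = ((P.L : ℝ) ^ k)⁻¹ * q * (B1.aSeq a P.L k * c₁ * Real.exp δ₁ *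
            (r₁ * Real.exp (-(δ₁ * t)) + r₂ * (t * Real.exp (-(δ₁ * t))))) := by ring
      _ ≤ ((P.L : ℝ) ^ k)⁻¹ * q * (B1.aSeq a P.L k * c₁ * Real.exp δ₁ *
            (r₁ * Real.exp (-(δ₁ * t)) + r₂ * (2 / δ₁ * Real.exp (-(δ₁ / 2 * t))))) :=
          mul_le_mul_of_nonneg_left (mul_le_mul_of_nonneg_left
            (add_le_add le_rfl (mul_le_mul_of_nonneg_left (mul_exp_neg_le_half hδ₁ t) hr₂)) (by positivity)) (by positivity)
      _ = _ := by ring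
  have hB1 : 0 ≤ ((P.L : ℝ) ^ k)⁻¹ * q *
      (B1.aSeq a P.L k * (c₀ * Real.exp δ₀) * Real.exp δ₀ * (r₁ * Real.exp (-(δ₀ * t)) + 2 * r₂ / δ₀ * Real.exp (-(δ₀ / 2 * t)))) := by
    positivity
  have hB2 : 0 ≤ ((P.L : ℝ) ^ k)⁻¹ * q *
      (B1.aSeq a P.L k * c₁ * Real.exp δ₁ * (r₁ * Real.exp (-(δ₁ * t)) + 2 * r₂ / δ₁ * Real.exp (-(δ₁ / 2 * t)))) := by
    positivity
  rw [hsplit, mul_add]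
  refine (norm_add_le _ _).trans (add_le_add ?_ ?_)
  · by_cases hζ : ζ (x.shift ν) y' - ζ x y' = 0
    · rw [hζ, zero_smul, norm_zero]; exact hB1
    · -- one of the two cut-off values is non-zero, so `y′` is within range `+1` of `x_k`
      have hy' : y' ∈ Λ₁ := by
        by_cases h0 : ζ x y' = 0
        · have h1 : ζ (x.shift ν) y' ≠ 0 := by intro h; exact hζ (by rw [h, h0, sub_zero])
          exact nbhd x y' hx (tdist_le_of_shift_le hk x ν y' (zeta_supp _ y' h1))
        · exact nbhd x y' hx ((zeta_supp x y' h0).trans (by linarith))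
      exact hP1 hy'
  · by_cases hζ : ζ x y' = 0
    · rw [hζ, zero_smul, norm_zero]; exact hB2
    · exact hP2 (nbhd x y' hx ((zeta_supp x y' hζ).trans (by linarith)))

/-- **The second sum of (2.64), pointwise**: the `y′`-term of `a_k(∂^η_ν(1 − ζ^{(k)})G_kQ_k^*1)(x)A(y)`, i.e.
`(1 − ζ(x+εe_ν,y′))K(x+εe_ν,y′)A(y) − (1 − ζ(x,y′))K(x,y′)A(y)`, vanishes unless one of the two cut-off values is `≠ 1`, hence only
for `|x_k − y′| > ρ₁ − 1` where the kernel has decayed: `≤ L^{−k}·t_A·[a_k(c₀e^{δ₀})e^{δ₀}e^{−δ₀(ρ₁−1)/2}e^{−δ₀t/2} +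
2a_kc₁e^{δ₁}e^{−δ₁ρ₁/2}e^{−δ₁t/2}]`. [cite: Balaban1982Higgs2, (2.64) p.571, (2.44) p.566, (2.58) p.570] -/
theorem norm_termD2_le (hk : k ≤ P.K) (hak : 0 ≤ B1.aSeq a P.L k) {δ₀ c₀ : ℝ} (hδ₀ : 0 < δ₀) (hc₀ : 0 ≤ c₀)
    (hV : ValueDecayAt P C msq a k δ₀ c₀) {δ₁ c₁ : ℝ} (hδ₁ : 0 < δ₁) (hc₁ : 0 ≤ c₁) (hD : DerivDecayAt P C msq a k δ₁ c₁)
    (ζ : HiggsLattice.Site P 0 → HiggsLattice.Site P k → ℝ) {ρ₁ : ℝ}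
    (zeta_abs : ∀ x y', |ζ x y'| ≤ 1)
    (zeta_one : ∀ x y', (HiggsLattice.Site.tdist (blockIter k x) y' : ℝ) ≤ ρ₁ → ζ x y' = 1)
    (zeta_lip : ∀ (x : HiggsLattice.Site P 0) (ν : Fin P.d) (y' : HiggsLattice.Site P k),
      |ζ (x.shift ν) y' - ζ x y'| ≤ ((P.L : ℝ) ^ k)⁻¹)
    {v : E N} {tA : ℝ} (hv : ‖v‖ ≤ tA) (x : HiggsLattice.Site P 0) (ν : Fin P.d) (y' : HiggsLattice.Site P k) :
    ‖(1 - ζ (x.shift ν) y') • kerAt C msq a k (x.shift ν) y' v - (1 - ζ x y') • kerAt C msq a k x y' v‖ ≤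
      ((P.L : ℝ) ^ k)⁻¹ * tA *
        (B1.aSeq a P.L k * (c₀ * Real.exp δ₀) * Real.exp δ₀ * Real.exp (-(δ₀ / 2 * (ρ₁ - 1))) *
            Real.exp (-(δ₀ / 2 * (HiggsLattice.Site.tdist (blockIter k x) y' : ℝ)))
          + 2 * B1.aSeq a P.L k * c₁ * Real.exp δ₁ * Real.exp (-(δ₁ / 2 * ρ₁)) *
            Real.exp (-(δ₁ / 2 * (HiggsLattice.Site.tdist (blockIter k x) y' : ℝ)))) := by
  set t : ℝ := (HiggsLattice.Site.tdist (blockIter k x) y' : ℝ) with ht_def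
  set K' := kerAt C msq a k (x.shift ν) y' with hK'_def
  set K := kerAt C msq a k x y' with hK_def
  have htA : 0 ≤ tA := (norm_nonneg _).trans hv
  have hLk : 0 < ((P.L : ℝ) ^ k)⁻¹ := inv_pos.mpr (pow_pos (Nat.cast_pos.mpr P.hL) k)
  have hsplit : (1 - ζ (x.shift ν) y') • K' v - (1 - ζ x y') • K v
      = -((ζ (x.shift ν) y' - ζ x y') • K' v) + (1 - ζ x y') • (K' v - K v) := by
    simp only [sub_smul, one_smul, smul_sub]; abel
  have hB1 : 0 ≤ ((P.L : ℝ) ^ k)⁻¹ * tA * (B1.aSeq a P.L k * (c₀ * Real.exp δ₀) * Real.exp δ₀ *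
      Real.exp (-(δ₀ / 2 * (ρ₁ - 1))) * Real.exp (-(δ₀ / 2 * t))) := by positivity
  have hB2 : 0 ≤ ((P.L : ℝ) ^ k)⁻¹ * tA * (2 * B1.aSeq a P.L k * c₁ * Real.exp δ₁ * Real.exp (-(δ₁ / 2 * ρ₁)) *
      Real.exp (-(δ₁ / 2 * t))) := by positivity
  rw [hsplit, mul_add]
  refine (norm_add_le _ _).trans (add_le_add ?_ ?_)
  · rw [norm_neg]
    by_cases hζ : ζ (x.shift ν) y' - ζ x y' = 0
    · rw [hζ, zero_smul, norm_zero]; exact hB1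
    · -- not both cut-off values are `1`: the label is beyond the plateau (up to one block)
      have ht : ρ₁ - 1 < t := by
        by_contra hle
        have hle' : t ≤ ρ₁ - 1 := not_lt.mp hle
        have h1 : ζ x y' = 1 := zeta_one x y' (by linarith)
        have h2 : ζ (x.shift ν) y' = 1 := by
          refine zeta_one _ y' ?_
          have h3 := B1Ineq234LevelZero.tdist_triangle_real (blockIter k (x.shift ν)) (blockIter k x) y'
          have h4 : (HiggsLattice.Site.tdist (blockIter k (x.shift ν)) (blockIter k x) : ℝ) ≤ 1 := by
            rw [B1Ineq234LevelZero.tdist_comm]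
            exact_mod_cast tdist_blockIter_shift_le_one hk x ν
          linarith
        exact hζ (by rw [h1, h2, sub_self])
      have hK' := norm_kerAt_le C msq a hk hδ₀.le hc₀ hV hak (x.shift ν) y' v
      have hE := exp_shift_le hk hδ₀.le x ν y'
      have hexp : Real.exp (-(δ₀ * t)) ≤ Real.exp (-(δ₀ / 2 * (ρ₁ - 1))) * Real.exp (-(δ₀ / 2 * t)) := by
        rw [← Real.exp_add, Real.exp_le_exp]
        nlinarith
      rw [norm_smul, Real.norm_eq_abs]
      calc |ζ (x.shift ν) y' - ζ x y'| * ‖K' v‖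
          ≤ ((P.L : ℝ) ^ k)⁻¹ * (B1.aSeq a P.L k * c₀ * Real.exp δ₀ * (Real.exp δ₀ * Real.exp (-(δ₀ * t))) * tA) := by
            refine mul_le_mul (zeta_lip x ν y') (hK'.trans ?_) (norm_nonneg _) hLk.le
            exact mul_le_mul (mul_le_mul_of_nonneg_left hE (by positivity)) hv (norm_nonneg _) (by positivity)
        _ ≤ ((P.L : ℝ) ^ k)⁻¹ * (B1.aSeq a P.L k * c₀ * Real.exp δ₀ *
              (Real.exp δ₀ * (Real.exp (-(δ₀ / 2 * (ρ₁ - 1))) * Real.exp (-(δ₀ / 2 * t)))) * tA) := by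
            gcongr
        _ = _ := by ring
  · by_cases hζ : ζ x y' = 1
    · rw [hζ, sub_self, zero_smul, norm_zero]; exact hB2
    · have ht : ρ₁ < t := by
        by_contra h
        exact hζ (zeta_one x y' (not_lt.mp h))
      have hKd := norm_kerAt_shift_sub_le C msq a hk hδ₁.le hc₁ hD hak x ν y' v
      have h1ζ : |1 - ζ x y'| ≤ 2 := by
        have := zeta_abs x y'
        rw [abs_le] at this ⊢
        constructor <;> linarith [this.1, this.2]
      have hexp : Real.exp (-(δ₁ * t)) ≤ Real.exp (-(δ₁ / 2 * ρ₁)) * Real.exp (-(δ₁ / 2 * t)) := by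
        rw [← Real.exp_add, Real.exp_le_exp]
        nlinarith
      rw [norm_smul, Real.norm_eq_abs]
      calc |1 - ζ x y'| * ‖K' v - K v‖
          ≤ 2 * (((P.L : ℝ) ^ k)⁻¹ * (B1.aSeq a P.L k * c₁ * Real.exp δ₁ * Real.exp (-(δ₁ * t)) * tA)) := by
            refine mul_le_mul h1ζ (hKd.trans ?_) (norm_nonneg _) zero_le_two
            exact mul_le_mul_of_nonneg_left (mul_le_mul_of_nonneg_left hv (by positivity)) hLk.le
        _ ≤ 2 * (((P.L : ℝ) ^ k)⁻¹ * (B1.aSeq a P.L k * c₁ * Real.exp δ₁ *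
              (Real.exp (-(δ₁ / 2 * ρ₁)) * Real.exp (-(δ₁ / 2 * t))) * tA)) := by
            gcongr
        _ = _ := by ring

/-- **The decomposition (2.64)** of the fine difference of the cut-off minimizer (the (2.63) constant CANCELS:
*"because G_kQ_k^*1 is a constant"*): with `y = x_k`, `w(y′) = A(y′) − A(y)`,
`A^{(k)}(x + εe_ν) − A^{(k)}(x) = Σ_{y′}[ζ(x+εe_ν,y′)K(x+εe_ν,y′)w − ζ(x,y′)K(x,y′)w]
 − Σ_{y′}[(1 − ζ(x+εe_ν,y′))K(x+εe_ν,y′)A(y) − (1 − ζ(x,y′))K(x,y′)A(y)]`. [cite: Balaban1982Higgs2, (2.64) p.571] -/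
theorem cutMin_shift_sub_eq (hk : k ≤ P.K) (hmsq : 0 < msq) (hak : 0 ≤ B1.aSeq a P.L k)
    (ζ : HiggsLattice.Site P 0 → HiggsLattice.Site P k → ℝ) (A : HiggsLattice.ScalarField P k N) (x : HiggsLattice.Site P 0)
    (ν : Fin P.d) :
    cutMin C msq a k ζ A (x.shift ν) - cutMin C msq a k ζ A x
      = (∑ y' : HiggsLattice.Site P k, (ζ (x.shift ν) y' • kerAt C msq a k (x.shift ν) y' (A y' - A (blockIter k x))
          - ζ x y' • kerAt C msq a k x y' (A y' - A (blockIter k x))))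
        - (∑ y' : HiggsLattice.Site P k, ((1 - ζ (x.shift ν) y') • kerAt C msq a k (x.shift ν) y' (A (blockIter k x))
          - (1 - ζ x y') • kerAt C msq a k x y' (A (blockIter k x)))) := by
  have hκ : ∑ y' : HiggsLattice.Site P k, kerAt C msq a k (x.shift ν) y' (A (blockIter k x))
      = ∑ y' : HiggsLattice.Site P k, kerAt C msq a k x y' (A (blockIter k x)) := by
    rw [sum_kerAt C msq a k hk hmsq hak, sum_kerAt C msq a k hk hmsq hak]
  rw [cutMin_eq_sum, cutMin_eq_sum]
  have h : ∀ (z : HiggsLattice.Site P 0) (y' : HiggsLattice.Site P k), ζ z y' • kerAt C msq a k z y' (A y')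
      = ζ z y' • kerAt C msq a k z y' (A y' - A (blockIter k x))
        - (1 - ζ z y') • kerAt C msq a k z y' (A (blockIter k x)) + kerAt C msq a k z y' (A (blockIter k x)) := by
    intro z y'
    rw [map_sub, smul_sub, sub_smul, one_smul]
    abel
  simp_rw [h, Finset.sum_add_distrib, Finset.sum_sub_distrib, hκ]
  abel

/-- **LEMMA 2.3, (2.60), ON THE (Higgs)₂,₃ CARRIER**: under the hypotheses of `norm_cutMin_sub_le` plus the derivative-clause decay
shape (2.58)/(2.25) with `(δ₁, c₁)` and the printed smoothness of the cutoff `|ζ(x + εe_ν, y′) − ζ(x, y′)| ≤ L^{−k}` (`|∂^η_xζ^{(k)}| ≦ 1`,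
`η = L^{−k}`), for `y = x_k ∈ Λ₂` and every direction `ν` the fine difference of the minimizer is of size `L^{−k}` (one `η`-derivative on
the unit lattice `T₁^{(k)}`):
`‖A^{(k),ε}(x + εe_ν) − A^{(k),ε}(x)‖ ≤ L^{−k}·[q·(C₀ + C₁) + t_A·(F₀e^{−δ₀(ρ₁−1)/2} + F₁e^{−δ₁ρ₁/2})]` with the explicit constants of
`norm_termD1_le`/`norm_termD2_le` summed by `Σ_{y′}e^{−δ|y − y′|} ≤ K_d(δ)`; NO `μ₀²(Lᵏε)²/(a_k + μ₀²(Lᵏε)²)` term ((2.63) cancels).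
[cite: Balaban1982Higgs2, Lemma 2.3 (2.60) p.571, (2.64) p.571] -/
theorem norm_cutMin_shift_sub_le (hk : k ≤ P.K) (hmsq : 0 < msq) (hak : 0 ≤ B1.aSeq a P.L k) {δ₀ c₀ : ℝ} (hδ₀ : 0 < δ₀)
    (hc₀ : 0 ≤ c₀) (hV : ValueDecayAt P C msq a k δ₀ c₀) {δ₁ c₁ : ℝ} (hδ₁ : 0 < δ₁) (hc₁ : 0 ≤ c₁)
    (hD : DerivDecayAt P C msq a k δ₁ c₁) (ζ : HiggsLattice.Site P 0 → HiggsLattice.Site P k → ℝ) {ρ ρ₁ : ℝ}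
    (zeta_abs : ∀ x y', |ζ x y'| ≤ 1)
    (zeta_supp : ∀ x y', ζ x y' ≠ 0 → (HiggsLattice.Site.tdist (blockIter k x) y' : ℝ) ≤ ρ)
    (zeta_one : ∀ x y', (HiggsLattice.Site.tdist (blockIter k x) y' : ℝ) ≤ ρ₁ → ζ x y' = 1)
    (zeta_lip : ∀ (x : HiggsLattice.Site P 0) (ν : Fin P.d) (y' : HiggsLattice.Site P k),
      |ζ (x.shift ν) y' - ζ x y'| ≤ ((P.L : ℝ) ^ k)⁻¹)
    (Λ₁ Λ₂ : Finset (HiggsLattice.Site P k)) (sub : Λ₂ ⊆ Λ₁)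
    (nbhd : ∀ x y', blockIter k x ∈ Λ₂ → (HiggsLattice.Site.tdist (blockIter k x) y' : ℝ) ≤ ρ + 1 → y' ∈ Λ₁)
    (A : HiggsLattice.ScalarField P k N) {tA q r₁ r₂ : ℝ} (hq : 0 ≤ q) (hr₁ : 0 ≤ r₁) (hr₂ : 0 ≤ r₂)
    (hA_abs : ∀ y' ∈ Λ₁, ‖A y'‖ ≤ tA)
    (hA_var : ∀ y ∈ Λ₂, ∀ y' ∈ Λ₁, ‖A y' - A y‖ ≤ q * (r₁ + r₂ * (HiggsLattice.Site.tdist y y' : ℝ)))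
    (x : HiggsLattice.Site P 0) (hx : blockIter k x ∈ Λ₂) (ν : Fin P.d) :
    ‖cutMin C msq a k ζ A (x.shift ν) - cutMin C msq a k ζ A x‖ ≤
      ((P.L : ℝ) ^ k)⁻¹ *
        (q * (B1.aSeq a P.L k * (c₀ * Real.exp δ₀) * Real.exp δ₀ *
              (r₁ * B4Sect5Proof.latticeConst P.d δ₀ + 2 * r₂ / δ₀ * B4Sect5Proof.latticeConst P.d (δ₀ / 2))
            + B1.aSeq a P.L k * c₁ * Real.exp δ₁ *
              (r₁ * B4Sect5Proof.latticeConst P.d δ₁ + 2 * r₂ / δ₁ * B4Sect5Proof.latticeConst P.d (δ₁ / 2)))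
        + tA * (B1.aSeq a P.L k * (c₀ * Real.exp δ₀) * Real.exp δ₀ * Real.exp (-(δ₀ / 2 * (ρ₁ - 1))) *
              B4Sect5Proof.latticeConst P.d (δ₀ / 2)
            + 2 * B1.aSeq a P.L k * c₁ * Real.exp δ₁ * Real.exp (-(δ₁ / 2 * ρ₁)) * B4Sect5Proof.latticeConst P.d (δ₁ / 2))) := by
  set y := blockIter k x with hy_def
  have htA : 0 ≤ tA := (norm_nonneg _).trans (hA_abs y (sub hx))
  have hLk : 0 < ((P.L : ℝ) ^ k)⁻¹ := inv_pos.mpr (pow_pos (Nat.cast_pos.mpr P.hL) k)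
  rw [cutMin_shift_sub_eq C msq a hk hmsq hak ζ A x ν]
  have h10 := sum_profile_le hδ₀ y
  have h20 := sum_profile_le (half_pos hδ₀) y
  have h11 := sum_profile_le hδ₁ y
  have h21 := sum_profile_le (half_pos hδ₁) y
  have hS1 : ‖∑ y' : HiggsLattice.Site P k, (ζ (x.shift ν) y' • kerAt C msq a k (x.shift ν) y' (A y' - A y)
        - ζ x y' • kerAt C msq a k x y' (A y' - A y))‖ ≤
      ((P.L : ℝ) ^ k)⁻¹ *
        (q * (B1.aSeq a P.L k * (c₀ * Real.exp δ₀) * Real.exp δ₀ *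
              (r₁ * B4Sect5Proof.latticeConst P.d δ₀ + 2 * r₂ / δ₀ * B4Sect5Proof.latticeConst P.d (δ₀ / 2))
            + B1.aSeq a P.L k * c₁ * Real.exp δ₁ *
              (r₁ * B4Sect5Proof.latticeConst P.d δ₁ + 2 * r₂ / δ₁ * B4Sect5Proof.latticeConst P.d (δ₁ / 2)))) := by
    refine (norm_sum_le _ _).trans ?_
    refine (Finset.sum_le_sum fun y' _ => norm_termD1_le C msq a hk hak hδ₀ hc₀ hV hδ₁ hc₁ hD ζ zeta_abs zeta_supp zeta_lip
      Λ₁ Λ₂ nbhd A hq hr₁ hr₂ hA_var x hx ν y').trans ?_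
    rw [← Finset.mul_sum, Finset.sum_add_distrib, ← Finset.mul_sum, ← Finset.mul_sum, Finset.sum_add_distrib,
      Finset.sum_add_distrib, ← Finset.mul_sum, ← Finset.mul_sum, ← Finset.mul_sum, ← Finset.mul_sum]
    rw [mul_assoc]
    gcongr
  have hS2 : ‖∑ y' : HiggsLattice.Site P k, ((1 - ζ (x.shift ν) y') • kerAt C msq a k (x.shift ν) y' (A y)
        - (1 - ζ x y') • kerAt C msq a k x y' (A y))‖ ≤
      ((P.L : ℝ) ^ k)⁻¹ *
        (tA * (B1.aSeq a P.L k * (c₀ * Real.exp δ₀) * Real.exp δ₀ * Real.exp (-(δ₀ / 2 * (ρ₁ - 1))) *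
              B4Sect5Proof.latticeConst P.d (δ₀ / 2)
            + 2 * B1.aSeq a P.L k * c₁ * Real.exp δ₁ * Real.exp (-(δ₁ / 2 * ρ₁)) * B4Sect5Proof.latticeConst P.d (δ₁ / 2))) := by
    refine (norm_sum_le _ _).trans ?_
    refine (Finset.sum_le_sum fun y' _ => norm_termD2_le C msq a hk hak hδ₀ hc₀ hV hδ₁ hc₁ hD ζ zeta_abs zeta_one zeta_lip
      (hA_abs y (sub hx)) x ν y').trans ?_
    rw [← Finset.mul_sum, Finset.sum_add_distrib, ← Finset.mul_sum, ← Finset.mul_sum]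
    rw [mul_assoc]
    gcongr
  calc _ ≤ _ := norm_sub_le _ _
    _ ≤ _ := add_le_add hS1 hS2
    _ = _ := by ring

end Deriv

/-! ## §6 The torus sub-family: the decay shapes from p14's theorems, and Lemma 2.3 packaged with uniform constants -/

section Torus

/-- The value-clause decay shape holds on every torus of the sub-family `M·L′_μ = Lᵐ`, every coupling, every level `1 ≤ k ≤ K` with
`Lᵏε ≤ ε₀`, with ONE pair `(δ₀, c₀)` — p14's `propagatorK_decay_bound` ((2.25) value clause with decay, from [B4] Thm (1.10) on the
torus). [cite: Balaban1982Higgs1, Prop. 2.1 (2.25) p.610] [cite: Balaban1982Higgs2, Prop. 2.2 (2.58) p.570] -/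
theorem valueDecayAt_torus (d L N : ℕ) (hd : 1 ≤ d) (hL : Odd L ∧ 1 < L) {a : ℝ} (ha : 0 < a) {msq : ℝ} (hmsq : 0 ≤ msq)
    (ε₀ : ℝ) :
    ∃ δ₀ c₀ : ℝ, 0 < δ₀ ∧ 0 < c₀ ∧ ∀ (P : HiggsLattice.Params) (_S : Shape P), P.d = d → P.L = L →
      ∀ (C : ChargeData N) {k : ℕ}, 1 ≤ k → k ≤ P.K → P.mesh k ≤ ε₀ → ValueDecayAt P C msq a k δ₀ c₀ := by
  obtain ⟨δ₀, c₀, hδ, hc, h⟩ := propagatorK_decay_bound d L N hd hL ha hmsq ε₀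
  exact ⟨δ₀, c₀, hδ, hc, fun P S hPd hPL C _k hk1 hk hε => h P S hPd hPL C hk1 hk hε⟩

/-- The derivative-clause decay shape holds on every torus of the sub-family, every coupling, every level `1 ≤ k ≤ K` with `Lᵏε ≤ ε₀`,
with ONE pair `(δ₁, c₁)` — p14's `covDeriv_propagatorK_decay_bound` ((2.25) derivative clause with decay).
[cite: Balaban1982Higgs1, Prop. 2.1 (2.25) p.610] [cite: Balaban1982Higgs2, Prop. 2.2 (2.58) p.570] -/
theorem derivDecayAt_torus (d L N : ℕ) (hd : 1 ≤ d) (hL : Odd L ∧ 1 < L) {a : ℝ} (ha : 0 < a) {msq : ℝ} (hmsq : 0 ≤ msq)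
    (ε₀ : ℝ) :
    ∃ δ₁ c₁ : ℝ, 0 < δ₁ ∧ 0 < c₁ ∧ ∀ (P : HiggsLattice.Params) (_S : Shape P), P.d = d → P.L = L →
      ∀ (C : ChargeData N) {k : ℕ}, 1 ≤ k → k ≤ P.K → P.mesh k ≤ ε₀ → DerivDecayAt P C msq a k δ₁ c₁ := by
  obtain ⟨δ₁, c₁, hδ, hc, h⟩ := covDeriv_propagatorK_decay_bound d L N hd hL ha hmsq ε₀
  exact ⟨δ₁, c₁, hδ, hc, fun P S hPd hPL C _k hk1 hk hε => h P S hPd hPL C hk1 hk hε⟩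

/-- The (2.59) statement is the printed `A^{(k)}(x) = (Q_k^*A)(x) + O(·)` form as well: `(Q_k^*(0)A_k)(x) = A_k(x_k)`.
[cite: Balaban1982Higgs2, Lemma 2.3 (2.59) p.571] -/
theorem cutMin_sub_avgQkAdj (C : ChargeData N) (msq a : ℝ) (k : ℕ) (ζ : HiggsLattice.Site P 0 → HiggsLattice.Site P k → ℝ)
    (A : HiggsLattice.ScalarField P k N) (x : HiggsLattice.Site P 0) :
    cutMin C msq a k ζ A x - avgQkAdj C (0 : HiggsLattice.VecField P 0) k A x = cutMin C msq a k ζ A x - A (blockIter k x) := by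
  rw [avgQkAdj_zeroField_apply]

/-- Bookkeeping: `r₁K + (2r₂/δ)K′ ≤ (K + (2/δ)K′)·(r₁ + r₂)` for nonnegative `r₁, r₂, K, K′`, `δ > 0`.
[cite: Balaban1982Higgs2, Lemma 2.3 p.571] -/
theorem coeff_le {δ K K' r₁ r₂ : ℝ} (hδ : 0 < δ) (hK : 0 ≤ K) (hK' : 0 ≤ K') (hr₁ : 0 ≤ r₁) (hr₂ : 0 ≤ r₂) :
    r₁ * K + 2 * r₂ / δ * K' ≤ (K + 2 / δ * K') * (r₁ + r₂) := by
  have h1 : 0 ≤ 2 / δ * K' := by positivity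
  have h2 : r₁ * K + 2 * r₂ / δ * K' = r₁ * K + r₂ * (2 / δ * K') := by ring
  have h3 : (K + 2 / δ * K') * (r₁ + r₂) = r₁ * K + r₂ * (2 / δ * K') + (r₂ * K + r₁ * (2 / δ * K')) := by ring
  rw [h2, h3]
  have h4 : 0 ≤ r₂ * K + r₁ * (2 / δ * K') := add_nonneg (mul_nonneg hr₂ hK) (mul_nonneg hr₁ h1)
  linarith

/-- The uniform VARIATION constant `C₁` of Lemma 2.3 on the carrier (a function of `a`, the decay constants `(δ₀, c₀)`, `(δ₁, c₁)` of
(2.58) and the torus sums `K_d`): `a·(c₀e^{2δ₀}(K₀ + (2/δ₀)K₀′) + c₁e^{δ₁}(K₁ + (2/δ₁)K₁′)) + 1`. [cite: Balaban1982Higgs2, Lemma 2.3 p.571] -/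
def constVar (a c₀ δ₀ K₀ K₀' c₁ δ₁ K₁ K₁' : ℝ) : ℝ :=
  a * (c₀ * Real.exp (2 * δ₀) * (K₀ + 2 / δ₀ * K₀') + c₁ * Real.exp δ₁ * (K₁ + 2 / δ₁ * K₁')) + 1

/-- The uniform FAR-FIELD constant `C₂` of Lemma 2.3 on the carrier: `2a·(c₀e^{3δ₀}K₀′ + c₁e^{δ₁}K₁′) + 1`.
[cite: Balaban1982Higgs2, Lemma 2.3 p.571] -/
def constFar (a c₀ δ₀ K₀' c₁ δ₁ K₁' : ℝ) : ℝ :=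
  2 * a * (c₀ * Real.exp (3 * δ₀) * K₀' + c₁ * Real.exp δ₁ * K₁') + 1

/-- `C₁ > 0`. [cite: Balaban1982Higgs2, Lemma 2.3 p.571] -/
theorem constVar_pos {a c₀ δ₀ K₀ K₀' c₁ δ₁ K₁ K₁' : ℝ} (ha : 0 ≤ a) (hc₀ : 0 ≤ c₀) (hδ₀ : 0 < δ₀) (hK₀ : 0 ≤ K₀) (hK₀' : 0 ≤ K₀')
    (hc₁ : 0 ≤ c₁) (hδ₁ : 0 < δ₁) (hK₁ : 0 ≤ K₁) (hK₁' : 0 ≤ K₁') : 0 < constVar a c₀ δ₀ K₀ K₀' c₁ δ₁ K₁ K₁' := by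
  unfold constVar; positivity

/-- `C₂ > 0`. [cite: Balaban1982Higgs2, Lemma 2.3 p.571] -/
theorem constFar_pos {a c₀ δ₀ K₀' c₁ δ₁ K₁' : ℝ} (ha : 0 ≤ a) (hc₀ : 0 ≤ c₀) (hK₀' : 0 ≤ K₀') (hc₁ : 0 ≤ c₁) (hK₁' : 0 ≤ K₁') :
    0 < constFar a c₀ δ₀ K₀' c₁ δ₁ K₁' := by
  unfold constFar; positivity

/-- The (2.59) variation coefficient is `≤ C₁(r₁ + r₂)` (`a_k ≤ a`). [cite: Balaban1982Higgs2, Lemma 2.3 (2.59) p.571] -/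
theorem coeff59_le {ak a c₀ δ₀ K₀ K₀' c₁ δ₁ K₁ K₁' r₁ r₂ : ℝ} (hak0 : 0 ≤ ak) (hak : ak ≤ a) (hc₀ : 0 ≤ c₀) (hδ₀ : 0 < δ₀)
    (hK₀ : 0 ≤ K₀) (hK₀' : 0 ≤ K₀') (hc₁ : 0 ≤ c₁) (hδ₁ : 0 < δ₁) (hK₁ : 0 ≤ K₁) (hK₁' : 0 ≤ K₁') (hr₁ : 0 ≤ r₁) (hr₂ : 0 ≤ r₂) :
    ak * c₀ * Real.exp δ₀ * (r₁ * K₀ + 2 * r₂ / δ₀ * K₀') ≤ constVar a c₀ δ₀ K₀ K₀' c₁ δ₁ K₁ K₁' * (r₁ + r₂) := by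
  have ha : 0 ≤ a := hak0.trans hak
  have hE1 : Real.exp δ₀ ≤ Real.exp (2 * δ₀) := Real.exp_le_exp.mpr (by linarith)
  have hα : ak * c₀ * Real.exp δ₀ ≤ a * c₀ * Real.exp (2 * δ₀) :=
    mul_le_mul (mul_le_mul hak le_rfl hc₀ ha) hE1 (Real.exp_pos _).le (by positivity)
  have hM : 0 ≤ K₀ + 2 / δ₀ * K₀' := by positivity
  have hC : a * c₀ * Real.exp (2 * δ₀) * (K₀ + 2 / δ₀ * K₀') ≤ constVar a c₀ δ₀ K₀ K₀' c₁ δ₁ K₁ K₁' := by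
    unfold constVar
    have h2 : 0 ≤ a * (c₁ * Real.exp δ₁ * (K₁ + 2 / δ₁ * K₁')) + 1 := by positivity
    nlinarith
  calc ak * c₀ * Real.exp δ₀ * (r₁ * K₀ + 2 * r₂ / δ₀ * K₀')
      ≤ (a * c₀ * Real.exp (2 * δ₀)) * ((K₀ + 2 / δ₀ * K₀') * (r₁ + r₂)) :=
        mul_le_mul hα (coeff_le hδ₀ hK₀ hK₀' hr₁ hr₂) (by positivity) (by positivity)
    _ = (a * c₀ * Real.exp (2 * δ₀) * (K₀ + 2 / δ₀ * K₀')) * (r₁ + r₂) := by ring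
    _ ≤ _ := mul_le_mul_of_nonneg_right hC (by positivity)

/-- The (2.60) variation coefficient is `≤ C₁(r₁ + r₂)`. [cite: Balaban1982Higgs2, Lemma 2.3 (2.60) p.571] -/
theorem coeff60_le {ak a c₀ δ₀ K₀ K₀' c₁ δ₁ K₁ K₁' r₁ r₂ : ℝ} (hak0 : 0 ≤ ak) (hak : ak ≤ a) (hc₀ : 0 ≤ c₀) (hδ₀ : 0 < δ₀)
    (hK₀ : 0 ≤ K₀) (hK₀' : 0 ≤ K₀') (hc₁ : 0 ≤ c₁) (hδ₁ : 0 < δ₁) (hK₁ : 0 ≤ K₁) (hK₁' : 0 ≤ K₁') (hr₁ : 0 ≤ r₁) (hr₂ : 0 ≤ r₂) :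
    ak * (c₀ * Real.exp δ₀) * Real.exp δ₀ * (r₁ * K₀ + 2 * r₂ / δ₀ * K₀') + ak * c₁ * Real.exp δ₁ * (r₁ * K₁ + 2 * r₂ / δ₁ * K₁')
      ≤ constVar a c₀ δ₀ K₀ K₀' c₁ δ₁ K₁ K₁' * (r₁ + r₂) := by
  have ha : 0 ≤ a := hak0.trans hak
  have hE : ak * (c₀ * Real.exp δ₀) * Real.exp δ₀ = ak * c₀ * Real.exp (2 * δ₀) := by
    rw [show (2 : ℝ) * δ₀ = δ₀ + δ₀ by ring, Real.exp_add]; ring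
  rw [hE]
  have hα₀ : ak * c₀ * Real.exp (2 * δ₀) ≤ a * c₀ * Real.exp (2 * δ₀) :=
    mul_le_mul_of_nonneg_right (mul_le_mul_of_nonneg_right hak hc₀) (Real.exp_pos _).le
  have hα₁ : ak * c₁ * Real.exp δ₁ ≤ a * c₁ * Real.exp δ₁ :=
    mul_le_mul_of_nonneg_right (mul_le_mul_of_nonneg_right hak hc₁) (Real.exp_pos _).le
  have h0 := coeff_le hδ₀ hK₀ hK₀' hr₁ hr₂
  have h1 := coeff_le hδ₁ hK₁ hK₁' hr₁ hr₂
  have hM₀ : 0 ≤ K₀ + 2 / δ₀ * K₀' := by positivity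
  have hM₁ : 0 ≤ K₁ + 2 / δ₁ * K₁' := by positivity
  calc ak * c₀ * Real.exp (2 * δ₀) * (r₁ * K₀ + 2 * r₂ / δ₀ * K₀') + ak * c₁ * Real.exp δ₁ * (r₁ * K₁ + 2 * r₂ / δ₁ * K₁')
      ≤ (a * c₀ * Real.exp (2 * δ₀)) * ((K₀ + 2 / δ₀ * K₀') * (r₁ + r₂))
        + (a * c₁ * Real.exp δ₁) * ((K₁ + 2 / δ₁ * K₁') * (r₁ + r₂)) :=
        add_le_add (mul_le_mul hα₀ h0 (by positivity) (by positivity)) (mul_le_mul hα₁ h1 (by positivity) (by positivity))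
    _ = (constVar a c₀ δ₀ K₀ K₀' c₁ δ₁ K₁ K₁' - 1) * (r₁ + r₂) := by unfold constVar; ring
    _ ≤ _ := by nlinarith

/-- The (2.59) far-field coefficient is `≤ C₂e^{−δρ₁}` with `δ = ½min(δ₀, δ₁)`, `ρ₁ ≥ 0`. [cite: Balaban1982Higgs2, Lemma 2.3 (2.59) p.571] -/
theorem far59_le {ak a c₀ δ₀ K₀' c₁ δ₁ K₁' ρ₁ : ℝ} (hak0 : 0 ≤ ak) (hak : ak ≤ a) (hc₀ : 0 ≤ c₀) (hδ₀ : 0 < δ₀) (hK₀' : 0 ≤ K₀')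
    (hc₁ : 0 ≤ c₁) (hK₁' : 0 ≤ K₁') (hρ₁ : 0 ≤ ρ₁) :
    2 * ak * c₀ * Real.exp δ₀ * K₀' * Real.exp (-(δ₀ / 2 * ρ₁))
      ≤ constFar a c₀ δ₀ K₀' c₁ δ₁ K₁' * Real.exp (-(min δ₀ δ₁ / 2 * ρ₁)) := by
  have ha : 0 ≤ a := hak0.trans hak
  have hE1 : Real.exp δ₀ ≤ Real.exp (3 * δ₀) := Real.exp_le_exp.mpr (by linarith)
  have hmin := min_le_left δ₀ δ₁
  have hE2 : Real.exp (-(δ₀ / 2 * ρ₁)) ≤ Real.exp (-(min δ₀ δ₁ / 2 * ρ₁)) := Real.exp_le_exp.mpr (by nlinarith)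
  have hα : ak * c₀ * Real.exp δ₀ ≤ a * c₀ * Real.exp (3 * δ₀) :=
    mul_le_mul (mul_le_mul hak le_rfl hc₀ ha) hE1 (Real.exp_pos _).le (by positivity)
  have hC : 2 * (a * c₀ * Real.exp (3 * δ₀)) * K₀' ≤ constFar a c₀ δ₀ K₀' c₁ δ₁ K₁' := by
    unfold constFar
    have h2 : 0 ≤ 2 * a * (c₁ * Real.exp δ₁ * K₁') + 1 := by positivity
    nlinarith
  calc 2 * ak * c₀ * Real.exp δ₀ * K₀' * Real.exp (-(δ₀ / 2 * ρ₁))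
      = 2 * (ak * c₀ * Real.exp δ₀) * K₀' * Real.exp (-(δ₀ / 2 * ρ₁)) := by ring
    _ ≤ 2 * (a * c₀ * Real.exp (3 * δ₀)) * K₀' * Real.exp (-(min δ₀ δ₁ / 2 * ρ₁)) := by
        refine mul_le_mul ?_ hE2 (Real.exp_pos _).le (by positivity)
        exact mul_le_mul_of_nonneg_right (mul_le_mul_of_nonneg_left hα zero_le_two) hK₀'
    _ ≤ _ := mul_le_mul_of_nonneg_right hC (Real.exp_pos _).le

/-- The (2.60) far-field coefficient is `≤ C₂e^{−δρ₁}` with `δ = ½min(δ₀, δ₁)`, `ρ₁ ≥ 0`. [cite: Balaban1982Higgs2, Lemma 2.3 (2.60) p.571] -/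
theorem far60_le {ak a c₀ δ₀ K₀' c₁ δ₁ K₁' ρ₁ : ℝ} (hak0 : 0 ≤ ak) (hak : ak ≤ a) (hc₀ : 0 ≤ c₀) (hδ₀ : 0 < δ₀) (hK₀' : 0 ≤ K₀')
    (hc₁ : 0 ≤ c₁) (hK₁' : 0 ≤ K₁') (hρ₁ : 0 ≤ ρ₁) :
    ak * (c₀ * Real.exp δ₀) * Real.exp δ₀ * Real.exp (-(δ₀ / 2 * (ρ₁ - 1))) * K₀'
        + 2 * ak * c₁ * Real.exp δ₁ * Real.exp (-(δ₁ / 2 * ρ₁)) * K₁'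
      ≤ constFar a c₀ δ₀ K₀' c₁ δ₁ K₁' * Real.exp (-(min δ₀ δ₁ / 2 * ρ₁)) := by
  have ha : 0 ≤ a := hak0.trans hak
  have hmin₀ := min_le_left δ₀ δ₁
  have hmin₁ := min_le_right δ₀ δ₁
  have hE3 : Real.exp δ₀ * Real.exp δ₀ * Real.exp (-(δ₀ / 2 * (ρ₁ - 1)))
      ≤ Real.exp (3 * δ₀) * Real.exp (-(min δ₀ δ₁ / 2 * ρ₁)) := by
    rw [← Real.exp_add, ← Real.exp_add, ← Real.exp_add, Real.exp_le_exp]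
    nlinarith
  have hE4 : Real.exp (-(δ₁ / 2 * ρ₁)) ≤ Real.exp (-(min δ₀ δ₁ / 2 * ρ₁)) := Real.exp_le_exp.mpr (by nlinarith)
  have h1 : ak * (c₀ * Real.exp δ₀) * Real.exp δ₀ * Real.exp (-(δ₀ / 2 * (ρ₁ - 1))) * K₀'
      ≤ a * c₀ * (Real.exp (3 * δ₀) * Real.exp (-(min δ₀ δ₁ / 2 * ρ₁))) * K₀' := by
    have h2 : ak * (c₀ * Real.exp δ₀) * Real.exp δ₀ * Real.exp (-(δ₀ / 2 * (ρ₁ - 1))) * K₀'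
        = ak * c₀ * (Real.exp δ₀ * Real.exp δ₀ * Real.exp (-(δ₀ / 2 * (ρ₁ - 1)))) * K₀' := by ring
    rw [h2]
    exact mul_le_mul_of_nonneg_right (mul_le_mul (mul_le_mul_of_nonneg_right hak hc₀) hE3 (by positivity) (by positivity)) hK₀'
  have h3 : 2 * ak * c₁ * Real.exp δ₁ * Real.exp (-(δ₁ / 2 * ρ₁)) * K₁'
      ≤ 2 * a * c₁ * Real.exp δ₁ * Real.exp (-(min δ₀ δ₁ / 2 * ρ₁)) * K₁' := by
    gcongr
  refine (add_le_add h1 h3).trans ?_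
  have h4 : a * c₀ * (Real.exp (3 * δ₀) * Real.exp (-(min δ₀ δ₁ / 2 * ρ₁))) * K₀'
        + 2 * a * c₁ * Real.exp δ₁ * Real.exp (-(min δ₀ δ₁ / 2 * ρ₁)) * K₁'
      = (a * c₀ * Real.exp (3 * δ₀) * K₀' + 2 * a * c₁ * Real.exp δ₁ * K₁') * Real.exp (-(min δ₀ δ₁ / 2 * ρ₁)) := by ring
  rw [h4]
  refine mul_le_mul_of_nonneg_right ?_ (Real.exp_pos _).le
  unfold constFar
  have h5 : 0 ≤ a * c₀ * Real.exp (3 * δ₀) * K₀' := by positivity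
  nlinarith

/-- **LEMMA 2.3 ON THE (Higgs)₂,₃ CARRIER, UNIFORM OVER THE TORUS SUB-FAMILY.**  For `d ≥ 1`, odd `L > 1`, `a > 0`, `μ₀² > 0`, any
`ε₀` and `N` there are `δ > 0`, `C₁, C₂ > 0` (functions of `d, L, N, a, μ₀², ε₀` only) such that on every torus of the sub-family
`M·L′_μ = Lᵐ`, for every coupling `C`, every level `1 ≤ k ≤ K` with `Lᵏε ≤ ε₀`, every cutoff `ζ^{(k)}` with the printed properties
(2.44) (`|ζ| ≤ 1`, support radius `ρ`, plateau radius `ρ₁ ≥ 0` in block-label distance, `|ζ(x+εe_ν,·) − ζ(x,·)| ≤ L^{−k}`), all regions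
`Λ₂ ⊆ Λ₁ ⊂ T^{(k)}` with the range of `ζ` (+1) around `Bᵏ(Λ₂)` inside `Λ₁`, and every block field `A_k : T^{(k)} → ℝ^N` obeying (2.55)
in the integrated reading on `Λ₁` (`‖A_k‖ ≤ t_A`, `‖A_k(y′) − A_k(y)‖ ≤ q(r₁ + r₂|y − y′|)` for `y ∈ Λ₂`, `y′ ∈ Λ₁`), the cut-off minimizer
`A^{(k),ε} = a_k(Lᵏε)^{−2}ζ^{(k)}G^ε_kQ_k^*A_k` of (3.3) satisfies, for every `x` with `x_k ∈ Λ₂` and every direction `ν`: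
(2.59) `‖A^{(k),ε}(x) − A_k(x_k)‖ ≤ C₁(r₁ + r₂)q + C₂e^{−δρ₁}t_A + (μ₀²(Lᵏε)²/(a_k + μ₀²(Lᵏε)²))t_A`;
(2.60) `‖A^{(k),ε}(x + εe_ν) − A^{(k),ε}(x)‖ ≤ L^{−k}·(C₁(r₁ + r₂)q + C₂e^{−δρ₁}t_A)`.
With the printed thresholds (`q = p(L^{k−1}ε)`-sized, `t_A = c₁p/(μ₀L^{k−1}ε)`, `ρ₁ = ½r(Lᵏε)`) all three terms are `O(p(Lᵏε))`
(`μ₀²(Lᵏε)²·t_A = O(μ₀Lp·Lᵏε)`; `e^{−δρ₁}t_A = O(p)` by r14's `B2StepK.rDecayBeatsPowers` — cf. p23's `B2Lemma23Proof.sep23_of_rDecay`).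
[cite: Balaban1982Higgs2, Lemma 2.3 (2.59)–(2.60) p.571, (3.3) p.583, (2.44) p.566, (2.55) p.570] -/
theorem lemma23_higgsLattice (d L N : ℕ) (hd : 1 ≤ d) (hL : Odd L ∧ 1 < L) {a : ℝ} (ha : 0 < a) {msq : ℝ} (hmsq : 0 < msq)
    (ε₀ : ℝ) :
    ∃ δ C₁ C₂ : ℝ, 0 < δ ∧ 0 < C₁ ∧ 0 < C₂ ∧ ∀ (P : HiggsLattice.Params) (_S : Shape P), P.d = d → P.L = L →
      ∀ (C : ChargeData N) {k : ℕ}, 1 ≤ k → k ≤ P.K → P.mesh k ≤ ε₀ →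
      ∀ (ζ : HiggsLattice.Site P 0 → HiggsLattice.Site P k → ℝ) (ρ ρ₁ : ℝ), 0 ≤ ρ₁ →
        (∀ x y', |ζ x y'| ≤ 1) →
        (∀ x y', ζ x y' ≠ 0 → (HiggsLattice.Site.tdist (blockIter k x) y' : ℝ) ≤ ρ) →
        (∀ x y', (HiggsLattice.Site.tdist (blockIter k x) y' : ℝ) ≤ ρ₁ → ζ x y' = 1) →
        (∀ (x : HiggsLattice.Site P 0) (ν : Fin P.d) (y' : HiggsLattice.Site P k), |ζ (x.shift ν) y' - ζ x y'| ≤ ((P.L : ℝ) ^ k)⁻¹) →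
      ∀ (Λ₁ Λ₂ : Finset (HiggsLattice.Site P k)), Λ₂ ⊆ Λ₁ →
        (∀ x y', blockIter k x ∈ Λ₂ → (HiggsLattice.Site.tdist (blockIter k x) y' : ℝ) ≤ ρ + 1 → y' ∈ Λ₁) →
      ∀ (A : HiggsLattice.ScalarField P k N) (tA q r₁ r₂ : ℝ), 0 ≤ q → 0 ≤ r₁ → 0 ≤ r₂ →
        (∀ y' ∈ Λ₁, ‖A y'‖ ≤ tA) →
        (∀ y ∈ Λ₂, ∀ y' ∈ Λ₁, ‖A y' - A y‖ ≤ q * (r₁ + r₂ * (HiggsLattice.Site.tdist y y' : ℝ))) →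
      ∀ (x : HiggsLattice.Site P 0), blockIter k x ∈ Λ₂ →
        ‖cutMin C msq a k ζ A x - A (blockIter k x)‖ ≤
            C₁ * (r₁ + r₂) * q + C₂ * Real.exp (-(δ * ρ₁)) * tA
              + msq * P.mesh k ^ 2 / (B1.aSeq a P.L k + msq * P.mesh k ^ 2) * tA
        ∧ ∀ ν : Fin P.d, ‖cutMin C msq a k ζ A (x.shift ν) - cutMin C msq a k ζ A x‖ ≤
            ((P.L : ℝ) ^ k)⁻¹ * (C₁ * (r₁ + r₂) * q + C₂ * Real.exp (-(δ * ρ₁)) * tA) := by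
  obtain ⟨δ₀, c₀, hδ₀, hc₀, hV⟩ := valueDecayAt_torus d L N hd hL ha hmsq.le ε₀
  obtain ⟨δ₁, c₁, hδ₁, hc₁, hD⟩ := derivDecayAt_torus d L N hd hL ha hmsq.le ε₀
  have hK₀ := B4Sect5Proof.latticeConst_nonneg d hδ₀.le
  have hK₀' := B4Sect5Proof.latticeConst_nonneg d (half_pos hδ₀).le
  have hK₁ := B4Sect5Proof.latticeConst_nonneg d hδ₁.le
  have hK₁' := B4Sect5Proof.latticeConst_nonneg d (half_pos hδ₁).le
  refine ⟨min δ₀ δ₁ / 2,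
    constVar a c₀ δ₀ (B4Sect5Proof.latticeConst d δ₀) (B4Sect5Proof.latticeConst d (δ₀ / 2)) c₁ δ₁
      (B4Sect5Proof.latticeConst d δ₁) (B4Sect5Proof.latticeConst d (δ₁ / 2)),
    constFar a c₀ δ₀ (B4Sect5Proof.latticeConst d (δ₀ / 2)) c₁ δ₁ (B4Sect5Proof.latticeConst d (δ₁ / 2)),
    by positivity, constVar_pos ha.le hc₀.le hδ₀ hK₀ hK₀' hc₁.le hδ₁ hK₁ hK₁', constFar_pos ha.le hc₀.le hK₀' hc₁.le hK₁', ?_⟩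
  intro P S hPd hPL C k hk1 hk hε ζ ρ ρ₁ hρ₁ zeta_abs zeta_supp zeta_one zeta_lip Λ₁ Λ₂ sub nbhd A tA q r₁ r₂ hq hr₁ hr₂
    hA_abs hA_var x hx
  subst hPd
  have hLr : 1 < (P.L : ℝ) := by rw [hPL]; exact_mod_cast hL.2
  have hak0 : 0 < B1.aSeq a P.L k := B1.aSeq_pos ha hLr hk1
  have hak : B1.aSeq a P.L k ≤ a := B1.aSeq_le ha hLr k hk1
  have htA : 0 ≤ tA := (norm_nonneg _).trans (hA_abs _ (sub hx))
  have hVk : ValueDecayAt P C msq a k δ₀ c₀ := hV P S rfl hPL C hk1 hk hε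
  have hDk : DerivDecayAt P C msq a k δ₁ c₁ := hD P S rfl hPL C hk1 hk hε
  refine ⟨?_, fun ν => ?_⟩
  · have h59 := norm_cutMin_sub_le C msq a hk hmsq hak0.le hδ₀ hc₀.le hVk ζ zeta_abs zeta_supp zeta_one Λ₁ Λ₂ sub nbhd A hq
      hr₁ hr₂ hA_abs hA_var x hx
    have h1 := mul_le_mul_of_nonneg_right (coeff59_le hak0.le hak hc₀.le hδ₀ hK₀ hK₀' hc₁.le hδ₁ hK₁ hK₁' hr₁ hr₂) hq
    have h2 := mul_le_mul_of_nonneg_right (far59_le (δ₁ := δ₁) hak0.le hak hc₀.le hδ₀ hK₀' hc₁.le hK₁' hρ₁) htA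
    refine h59.trans ?_
    linarith
  · have h60 := norm_cutMin_shift_sub_le C msq a hk hmsq hak0.le hδ₀ hc₀.le hVk hδ₁ hc₁.le hDk ζ zeta_abs zeta_supp zeta_one
      zeta_lip Λ₁ Λ₂ sub nbhd A hq hr₁ hr₂ hA_abs hA_var x hx ν
    have h1 := mul_le_mul_of_nonneg_left (coeff60_le hak0.le hak hc₀.le hδ₀ hK₀ hK₀' hc₁.le hδ₁ hK₁ hK₁' hr₁ hr₂) hq
    have h2 := mul_le_mul_of_nonneg_left (far60_le (δ₁ := δ₁) hak0.le hak hc₀.le hδ₀ hK₀' hc₁.le hK₁' hρ₁) htA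
    refine h60.trans (mul_le_mul_of_nonneg_left ?_ (inv_nonneg.mpr (pow_nonneg (Nat.cast_nonneg _) k)))
    linarith

end Torus

end Literature.MathematicalPhysics.QuantumFieldTheory.Balaban1983to89.B2Lemma23HiggsLattice

end
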